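import Literature.NumberTheory.Automorphic.RamakrishnanMultiplicityOneLemma414
import Literature.NumberTheory.Automorphic.AutomorphicInductionCuspidalProofs
import Literature.NumberTheory.Automorphic.ArthurClozelCuspidalDescentGLOneHolds
import Literature.NumberTheory.Automorphic.GLOneOfHeckeCharacter
import Literature.NumberTheory.Automorphic.StrongMultiplicityOneRankinSelberg
import Literature.NumberTheory.Automorphic.LanglandsTetrahedralLeaves
import Literature.NumberTheory.Automorphic.CuspidalDescentDetCubicRepData
import Literature.NumberTheory.Automorphic.PairLFunctionPolesGLOneTateProofs
import Literature.NumberTheory.Automorphic.PairLFunctionPolesGLOneDedekindProofs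
import Literature.NumberTheory.GaloisRepresentations.HeckeCharacterGaloisAvatarProofs
import Literature.NumberTheory.GaloisRepresentations.ArtinReciprocityPerPrime
import Literature.NumberTheory.GaloisRepresentations.HeckeCharacterCofiniteProofs
import HarnessLib

/-!
# Ramakrishnan, Thm. 4.1.2: the both-dihedral case, and the theorem from named facts (proof file)

Topic `NumberTheory/Automorphic`; namespace `Literature.NumberTheory.Automorphic`. Proof file
(theorems only: no definition, no named fact, no instance) next to `RamakrishnanTensorProductGL2`
(the named fact `Ramakrishnan2000_multiplicityOneSL2` — D. Ramakrishnan, *Modularity of the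
Rankin–Selberg `L`-series, and multiplicity one for `SL(2)`*, Ann. of Math. 152 (2000), Thm. 4.1.2:
"Let `π, π'` be unitary, cuspidal automorphic representations of `GL(2, 𝔸_F)`. Suppose
`Ad(π_v) ≃ Ad(π'_v)` for almost all `v`. Then there exists an idele class character `χ` … such that
`π' ≃ π ⊗ χ`"), `RamakrishnanTensorProductGL2Proofs` (step 1: under `(LL)` both or neither of
`π, π'` is dihedral; step 3: the assembly `Ramakrishnan2000_multiplicityOneSL2.of_theoremM` from
Theorem M, Lemma 4.1.4 and **the both-dihedral case `hdih`**) and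
`RamakrishnanMultiplicityOneLemma414` (Lemma 4.1.4 from named facts).

This file proves the remaining clause `hdih` — the case of the printed proof (op. cit. §4.1,
p. 38) where `π` and `π'` are both dihedral — from named facts of the tree, and assembles
**Thm. 4.1.2 from named facts only** (`Ramakrishnan2000_multiplicityOneSL2.of_named_facts`).

## The printed argument (p. 38) and its formalisation

> "Suppose `π` is dihedral, i.e. `π = I_K^F(μ)` … `π ≅ π ⊗ δ` … `π'` is also dihedral … `π'`
> is of the form `I_K^F(μ')` … base change to `K` … `{μ/(μ∘θ), (μ∘θ)/μ} = {μ'/(μ'∘θ), (μ'∘θ)/μ'}`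
> … `μ/μ'` [or `(μ∘θ)/μ'`] is `θ`-invariant … there exists an idele class character `χ` of `F`
> with `μ' = μ · χ_K` … `π' ≅ I_K^F(μ) ⊗ χ ≅ π ⊗ χ`."

In the tree's Satake rendering (`IsSatakeSelfTwist`, `IsSatakeTwistBy`, Borel–Jacquet data
`CuspidalAutomorphicRepData 2 F h2`):

* `HeckeCharacter.eq_one_or_eq_one_of_eventually_valueAtUniformizer` (**dichotomy for pairs of
  Hecke characters**, the rank-one shadow of Jacquet–Shalika's strong multiplicity one for isobaric
  sums used in the comparison of the two-element sets above): unitary `ν, ν₂` trivial on `A_G` with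
  `ν(ϖ_v) = 1` or `ν₂(ϖ_v) = 1` at almost every `v` satisfy `ν = 1` or `ν₂ = 1` — by the exact
  identity of Euler factors `L^S(s, νν₂) L^S(s, ν)⁻¹ L^S(s, ν₂)⁻¹ ζ_K^S(s) = 1` and the behaviour at
  `s = 1` (Hecke–Landau from **Tate's continuation theorem**, the named fact
  `heckeLFunction_hasEntireContinuation_of_not_isNormTwist`, through
  `exists_ne_zero_tendsto_partialHeckeL_of_tate`; the pole of `ζ_K^S`,
  `tendsto_sub_one_mul_tprod_eulerFactor_one_numberField`, is proved in the tree).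
* `HeckeCharacter.exists_quadratic_valueAtUniformizer_eq_one_iff`,
  `HeckeCharacter.exists_isClassFieldCharacter_of_sq_eq_one` (**"`δ = χ_{K/F}` for a quadratic
  `K`"**, class field theory, proved in the tree: `HeckeCharacter.exists_eq_charHecke_of_isFiniteOrder`,
  `artinIdeleMap_surjective`, the Galois correspondence, consistency of Frobenii
  `restrictNormalHom_galFrob_eq_galFrob_of_isUnramifiedIn`, and
  `exists_isClassFieldCharacter_holds` with rigidity of Hecke characters).
* `Ramakrishnan2000_dihedral_core` (**the displayed argument**, model-free): from the
  automorphic-induction relations `{μ(ϖ_w)} + {μ^σ(ϖ_w)} = t_v^{f(w|v)}` for `π` and `π'`, `(LL)`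
  and the self-twist, a Hecke character `χ` of `F` with `t'_v = χ(ϖ_v) t_v` a.e.: the dichotomy
  above applied to `ν = (μ'/μ)/(μ'/μ)^σ`, `ν₂ = (μ'/μ^σ)/(μ'/μ^σ)^σ`, then Hilbert 90 for idele
  class characters (`HeckeCharacter.exists_baseChange_eq_of_forall_smul_eq`, proved in the tree)
  and `(χ ∘ N)(ϖ_w) = χ(ϖ_v)^{f}` (`HeckeCharacter.eventually_valueAtUniformizer_baseChange`).
* `exists_inducing_heckeCharacters_of_twist_eq` (**"`π = I_K^F(μ)`"**, Labesse–Langlands /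
  op. cit. Prop. 2.3.1 (2), here **Arthur–Clozel, Ch. 3, Thm. 4.2 (b)**, the named fact
  `ArthurClozel1989_inducedLift_of_twist_eq 2 F E`, read in rank one through the tree's `GL(1)`
  dictionary `CuspidalAutomorphicRepGL.heckeCharacter`, `heckeCharacter_galConj_apply`,
  `IsWeakBaseChangeLiftOfGalOrbit.eventually_sum_eq_map_pow`).
* `twistByFiniteOrderChar_eq_self_of_isSatakeTwistBy` (a Satake-level self-twist is `P ⊗ δ = P`
  in `L²_cusp`: **strong multiplicity one**, `eq_of_isSatakeFamilyOf_of_jacquetShalika`, from the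
  named facts `multiplicity_one_gl` and Jacquet–Shalika (2.2)–(2.3)
  `JacquetShalika1981_partialPairL_at_one_of_ne_conj` / `…_pole_of_eq_conj` over `F`).
* `Ramakrishnan2000_multiplicityOneSL2.dihedral_of_AC` (**the clause `hdih`**): the unitary `L²`
  normalisation `t_π = q^s α_P` of a cuspidal datum (`exists_satake_eq_cpow_mul_L2_of_clean`, from
  the Borel–Jacquet dictionary leaves `exists_isAssociatedL2`, `hasSatakeParamAt_iff_L2`,
  `stable_cuspidal_eq_sSup_irreducible`, the same three leaves as Lemma 4.1.4), the four items
  above, and the untwisting `t_{π'} = (χ ‖·‖^{s-s'})(ϖ_v) t_π`.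
* `Ramakrishnan2000_multiplicityOneSL2.of_named_facts` — **Thm. 4.1.2 from named facts only**:
  Theorem M (`Ramakrishnan2000_theoremM`), Jacquet–Shalika for Borel–Jacquet data (`…_repData`,
  Lemma 4.1.4), Gelbart–Jacquet (`GelbartJacquet_adjoint_lift`), Tate, Arthur–Clozel (b),
  multiplicity one and Jacquet–Shalika in `L²`, and the three dictionary leaves. So
  `Ramakrishnan2000_multiplicityOneSL2_holds` is this theorem fed with the discharges of those named
  facts, once they exist.

Deviation from print: Ramakrishnan compares the base changes of `Ad(π) = Ad(π')` to `K` as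
isobaric sums on `GL(3)/K` ([JS2] Thm. 4.4); the tree has no isobaric sums, so the comparison is
made entrywise on the induced Satake parameters `{μ_w, μ^σ_w}` vs `{μ'_w, μ'^σ_w} = c_v {μ_w, μ^σ_w}`
(which is what `(LL)` gives directly), and [JS2] Thm. 4.4 is replaced by its rank-one shadow, the
dichotomy lemma, proved here from Tate's theorem. Nothing is weakened: the conclusion is the
clause `hdih` verbatim.

## References

* D. Ramakrishnan, *Modularity of the Rankin–Selberg `L`-series, and multiplicity one for
  `SL(2)`*, Ann. of Math. (2) 152 (2000), 45–111, §2.3 Prop. 2.3.1, §4.1 Thm. 4.1.2 and its proof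
  (pp. 37–39). [Ramakrishnan2000]
* J. Arthur, L. Clozel, *Simple algebras, base change, and the advanced theory of the trace
  formula*, Ann. of Math. Stud. 120 (1989), Ch. 3, §1 (1.1), Thm. 4.2 (b), §6. [ArthurClozelAMS120]
* J. Tate, *Fourier analysis in number fields and Hecke's zeta-functions*; *Global class field
  theory*, in Cassels–Fröhlich, *Algebraic Number Theory* (1967), Ch. XV Thm. 4.4.1; Ch. VII §4
  Prop. 4.1, §5.1. [TateThesis1967] [CasselsFrohlichANT1967]
* H. Jacquet, J. A. Shalika, *On Euler products and the classification of automorphic forms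
  I–II*, Amer. J. Math. 103 (1981), Thm. 4.4, Prop. 3.6. [JacquetShalikaAJM1981II]
-/

noncomputable section

open scoped Topology NNReal
open NumberField IsDedekindDomain MeasureTheory Filter Complex Set Polynomial
open Literature.NumberTheory.GaloisRepresentations

namespace Literature.NumberTheory.Automorphic

open AdelicGroupData


section Dichotomy

variable {K : Type} [Field K] [NumberField K]

/-- `1(ϖ_v) = 1`. [folklore] -/
private theorem valueAtUniformizer_one_dih (v : HeightOneSpectrum (𝓞 K)) :
    (1 : HeckeCharacter K).valueAtUniformizer v = 1 := by
  rw [HeckeCharacter.valueAtUniformizer, HeckeCharacter.localComponent_apply,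
    HeckeCharacter.one_apply, Units.val_one]

/-- The filter `𝓝[{Re s > 1}] 1` on `ℂ` is non-trivial (`1 + t`, `t → 0⁺`). [folklore] -/
private theorem neBot_nhdsWithin_one_lt_re_dih : (𝓝[{s : ℂ | 1 < s.re}] (1 : ℂ)).NeBot := by
  refine mem_closure_iff_nhdsWithin_neBot.mp ?_
  refine Metric.mem_closure_iff.mpr fun ε hε => ⟨1 + (ε / 2 : ℝ), ?_, ?_⟩
  · show 1 < (1 + ((ε / 2 : ℝ) : ℂ)).re
    simp only [Complex.add_re, Complex.one_re, Complex.ofReal_re]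
    linarith
  · rw [dist_eq_norm]
    have : (1 : ℂ) - (1 + ((ε / 2 : ℝ) : ℂ)) = -((ε / 2 : ℝ) : ℂ) := by ring
    rw [this, norm_neg, Complex.norm_real, Real.norm_eq_abs, abs_of_pos (by linarith)]
    linarith

/-- Summability of `v ↦ ‖a_v q_v^{-s}‖` over the places outside `S`, for `|a_v| = 1` and
`Re s > 1`. [folklore] -/
private theorem summable_norm_valueAtUniformizer_mul_cpow_dih {χ : HeckeCharacter K}
    (hχ : χ.IsUnitary) (S : Set (HeightOneSpectrum (𝓞 K))) {s : ℂ} (hs : 1 < s.re) :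
    Summable fun v : {v : HeightOneSpectrum (𝓞 K) // v ∉ S} =>
      ‖χ.valueAtUniformizer v.1 * ((v.1.residueCard : ℂ) ^ (-s))‖ := by
  simp_rw [HeckeCharacter.norm_valueAtUniformizer_mul_cpow hχ]
  exact (Automorphic.summable_residueCard_rpow_neg hs).comp_injective Subtype.val_injective

/-- **Dichotomy for pairs of Hecke characters** (the rank-one shadow of strong multiplicity one
for isobaric sums of characters, Jacquet–Shalika 1981, Thm. 4.4, used in Ramakrishnan's dihedral
case, op. cit. p. 38: "`{μ/(μ∘θ), (μ∘θ)/μ} = {μ'/(μ'∘θ), (μ'∘θ)/μ'}`"). Let `ν, ν₂` be unitary Hecke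
characters of `K` trivial on `A_G = ℝ_{>0}` such that for all but finitely many finite places `v`,
`ν(ϖ_v) = 1` or `ν₂(ϖ_v) = 1`. Then `ν = 1` or `ν₂ = 1`. Proof by `L`-functions: at every such
`v` the Euler factors satisfy `(1 - νν₂(ϖ)X)⁻¹ (1 - ν(ϖ)X) (1 - ν₂(ϖ)X) (1 - X)⁻¹ = 1`, so
`L^S(s, νν₂) · L^S(s, ν)⁻¹ · L^S(s, ν₂)⁻¹ · ζ_K^S(s) = 1` on `Re s > 1`; if `ν, ν₂ ≠ 1` the two
middle factors have finite non-zero limits at `s = 1` (Hecke–Landau, from Tate's continuation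
theorem `heckeLFunction_hasEntireContinuation_of_not_isNormTwist`, hypothesis `hT`, through
`exists_ne_zero_tendsto_partialHeckeL_of_tate`), `ζ_K^S` has a pole
(`tendsto_sub_one_mul_tprod_eulerFactor_one_numberField`) and `L^S(s, νν₂)` a finite non-zero limit
or (if `νν₂ = 1`) a pole — contradiction. [cite: Ramakrishnan2000, §4.1, proof of Thm. 4.1.2 (p. 38)] -/
theorem HeckeCharacter.eq_one_or_eq_one_of_eventually_valueAtUniformizer
    (hT : ∀ χ : HeckeCharacter K, heckeLFunction_hasEntireContinuation_of_not_isNormTwist χ)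
    {ν ν₂ : HeckeCharacter K} (hν : ν.IsUnitary) (hν₂ : ν₂.IsUnitary)
    (hνA : ∀ t : ℝ≥0ˣ, ν (posRealIdele K t) = 1) (hν₂A : ∀ t : ℝ≥0ˣ, ν₂ (posRealIdele K t) = 1)
    (h : ∀ᶠ v : HeightOneSpectrum (𝓞 K) in cofinite,
      ν.valueAtUniformizer v = 1 ∨ ν₂.valueAtUniformizer v = 1) :
    ν = 1 ∨ ν₂ = 1 := by
  classical
  by_contra hne
  push Not at hne
  obtain ⟨h1, h2⟩ := hne
  -- the exceptional set
  set S : Set (HeightOneSpectrum (𝓞 K)) :=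
    {v | ¬ (ν.valueAtUniformizer v = 1 ∨ ν₂.valueAtUniformizer v = 1)} ∪
      ({v | ¬ ν.IsUnramifiedAt v} ∪ {v | ¬ ν₂.IsUnramifiedAt v}) with hSdef
  have hS : S.Finite := by
    refine (Filter.eventually_cofinite.mp h).union (Set.Finite.union ?_ ?_)
    · exact Filter.eventually_cofinite.mp (HeckeCharacter.isUnramifiedAt_cofinite_holds ν)
    · exact Filter.eventually_cofinite.mp (HeckeCharacter.isUnramifiedAt_cofinite_holds ν₂)
  have hSv : ∀ v ∉ S, ν.valueAtUniformizer v = 1 ∨ ν₂.valueAtUniformizer v = 1 := by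
    intro v hv; by_contra hc; exact hv (Or.inl hc)
  have hurν : ∀ v ∉ S, ν.IsUnramifiedAt v := by
    intro v hv; by_contra hc; exact hv (Or.inr (Or.inl hc))
  have hurν₂ : ∀ v ∉ S, ν₂.IsUnramifiedAt v := by
    intro v hv; by_contra hc; exact hv (Or.inr (Or.inr hc))
  have hur12 : ∀ v ∉ S, (ν * ν₂).IsUnramifiedAt v := fun v hv => (hurν v hv).mul (hurν₂ v hv)
  have h12u : (ν * ν₂).IsUnitary := hν.mul hν₂
  -- notation for the Euler factors
  set q : {v : HeightOneSpectrum (𝓞 K) // v ∉ S} → ℂ → ℂ := fun v s => (v.1.residueCard : ℂ) ^ (-s)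
    with hqdef
  set L₁ : ℂ → ℂ := fun s => ∏' v : {v : HeightOneSpectrum (𝓞 K) // v ∉ S},
    (1 - (ν * ν₂).valueAtUniformizer v.1 * q v s)⁻¹ with hL₁
  set Lν : ℂ → ℂ := fun s => ∏' v : {v : HeightOneSpectrum (𝓞 K) // v ∉ S},
    (1 - ν.valueAtUniformizer v.1 * q v s)⁻¹ with hLν
  set Lν₂ : ℂ → ℂ := fun s => ∏' v : {v : HeightOneSpectrum (𝓞 K) // v ∉ S},
    (1 - ν₂.valueAtUniformizer v.1 * q v s)⁻¹ with hLν₂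
  set M₂ : ℂ → ℂ := fun s => ∏' v : {v : HeightOneSpectrum (𝓞 K) // v ∉ S},
    (1 - ν.valueAtUniformizer v.1 * q v s) with hM₂
  set M₃ : ℂ → ℂ := fun s => ∏' v : {v : HeightOneSpectrum (𝓞 K) // v ∉ S},
    (1 - ν₂.valueAtUniformizer v.1 * q v s) with hM₃
  set Z : ℂ → ℂ := fun s => ∏' v : {v : HeightOneSpectrum (𝓞 K) // v ∉ S}, (1 - q v s)⁻¹ with hZ
  -- multipliability on `Re s > 1`
  have hmulInv : ∀ {χ : HeckeCharacter K}, χ.IsUnitary → ∀ {s : ℂ}, 1 < s.re →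
      Multipliable fun v : {v : HeightOneSpectrum (𝓞 K) // v ∉ S} =>
        (1 - χ.valueAtUniformizer v.1 * q v s)⁻¹ := fun hχ s hs =>
    multipliable_inv_one_sub_of_summable_norm (summable_norm_valueAtUniformizer_mul_cpow_dih hχ S hs)
  have hmulSub : ∀ {χ : HeckeCharacter K}, χ.IsUnitary → ∀ {s : ℂ}, 1 < s.re →
      Multipliable fun v : {v : HeightOneSpectrum (𝓞 K) // v ∉ S} =>
        (1 - χ.valueAtUniformizer v.1 * q v s) := by
    intro χ hχ s hs
    have hsum : Summable fun v : {v : HeightOneSpectrum (𝓞 K) // v ∉ S} =>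
        ‖-(χ.valueAtUniformizer v.1 * q v s)‖ := by
      simp_rw [norm_neg]
      exact summable_norm_valueAtUniformizer_mul_cpow_dih hχ S hs
    simpa only [sub_eq_add_neg] using multipliable_one_add_of_summable hsum
  have hmulZ : ∀ {s : ℂ}, 1 < s.re →
      Multipliable fun v : {v : HeightOneSpectrum (𝓞 K) // v ∉ S} => (1 - q v s)⁻¹ := by
    intro s hs
    have := hmulInv (χ := (1 : HeckeCharacter K)) HeckeCharacter.isUnitary_one hs
    simpa only [valueAtUniformizer_one_dih, one_mul] using this
  -- the pointwise identity of Euler factors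
  have hpt : ∀ (v : {v : HeightOneSpectrum (𝓞 K) // v ∉ S}) (s : ℂ), 1 < s.re →
      (1 - (ν * ν₂).valueAtUniformizer v.1 * q v s)⁻¹ * (1 - ν.valueAtUniformizer v.1 * q v s) *
        (1 - ν₂.valueAtUniformizer v.1 * q v s) * (1 - q v s)⁻¹ = 1 := by
    intro v s hs
    have hq1 : 1 - q v s ≠ 0 := one_sub_residueCard_cpow_neg_ne_zero v.1 (by linarith)
    rw [HeckeCharacter.valueAtUniformizer_mul]
    rcases hSv v.1 v.2 with h0 | h0
    · rw [h0, one_mul]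
      have hb : 1 - ν₂.valueAtUniformizer v.1 * q v s ≠ 0 := by
        intro hb
        have hn := congrArg (‖·‖) (sub_eq_zero.mp hb)
        simp only [norm_one] at hn
        rw [HeckeCharacter.norm_valueAtUniformizer_mul_cpow hν₂] at hn
        have : (v.1.residueCard : ℝ) ^ (-s.re) < 1 :=
          Real.rpow_lt_one_of_one_lt_of_neg (by exact_mod_cast v.1.one_lt_residueCard) (by linarith)
        linarith
      field_simp
    · rw [h0, mul_one]
      have hb : 1 - ν.valueAtUniformizer v.1 * q v s ≠ 0 := by
        intro hb
        have hn := congrArg (‖·‖) (sub_eq_zero.mp hb)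
        simp only [norm_one] at hn
        rw [HeckeCharacter.norm_valueAtUniformizer_mul_cpow hν] at hn
        have : (v.1.residueCard : ℝ) ^ (-s.re) < 1 :=
          Real.rpow_lt_one_of_one_lt_of_neg (by exact_mod_cast v.1.one_lt_residueCard) (by linarith)
        linarith
      field_simp
  -- hence `L₁ · M₂ · M₃ · Z = 1` and `Lν · M₂ = 1`, `Lν₂ · M₃ = 1` on `Re s > 1`
  have hprod : ∀ s : ℂ, 1 < s.re → L₁ s * M₂ s * M₃ s * Z s = 1 := by
    intro s hs
    have hP := (((hmulInv h12u hs).hasProd.mul (hmulSub hν hs).hasProd).mul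
      (hmulSub hν₂ hs).hasProd).mul (hmulZ hs).hasProd
    have h1' : HasProd (fun v : {v : HeightOneSpectrum (𝓞 K) // v ∉ S} =>
        (1 - (ν * ν₂).valueAtUniformizer v.1 * q v s)⁻¹ * (1 - ν.valueAtUniformizer v.1 * q v s) *
          (1 - ν₂.valueAtUniformizer v.1 * q v s) * (1 - q v s)⁻¹) 1 := by
      have : (fun v : {v : HeightOneSpectrum (𝓞 K) // v ∉ S} =>
        (1 - (ν * ν₂).valueAtUniformizer v.1 * q v s)⁻¹ * (1 - ν.valueAtUniformizer v.1 * q v s) *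
          (1 - ν₂.valueAtUniformizer v.1 * q v s) * (1 - q v s)⁻¹) = fun _ => 1 :=
        funext fun v => hpt v s hs
      rw [this]; exact hasProd_one
    exact (hP.unique h1')
  have hinvν : ∀ s : ℂ, 1 < s.re → Lν s * M₂ s = 1 := by
    intro s hs
    have hP := (hmulInv hν hs).hasProd.mul (hmulSub hν hs).hasProd
    have h1' : HasProd (fun v : {v : HeightOneSpectrum (𝓞 K) // v ∉ S} =>
        (1 - ν.valueAtUniformizer v.1 * q v s)⁻¹ * (1 - ν.valueAtUniformizer v.1 * q v s)) 1 := by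
      have : (fun v : {v : HeightOneSpectrum (𝓞 K) // v ∉ S} =>
          (1 - ν.valueAtUniformizer v.1 * q v s)⁻¹ * (1 - ν.valueAtUniformizer v.1 * q v s)) =
          fun _ => 1 := by
        funext v
        have hb : 1 - ν.valueAtUniformizer v.1 * q v s ≠ 0 := by
          intro hb
          have hn := congrArg (‖·‖) (sub_eq_zero.mp hb)
          simp only [norm_one] at hn
          rw [HeckeCharacter.norm_valueAtUniformizer_mul_cpow hν] at hn
          have : (v.1.residueCard : ℝ) ^ (-s.re) < 1 :=
            Real.rpow_lt_one_of_one_lt_of_neg (by exact_mod_cast v.1.one_lt_residueCard) (by linarith)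
          linarith
        exact inv_mul_cancel₀ hb
      rw [this]; exact hasProd_one
    exact hP.unique h1'
  have hinvν₂ : ∀ s : ℂ, 1 < s.re → Lν₂ s * M₃ s = 1 := by
    intro s hs
    have hP := (hmulInv hν₂ hs).hasProd.mul (hmulSub hν₂ hs).hasProd
    have h1' : HasProd (fun v : {v : HeightOneSpectrum (𝓞 K) // v ∉ S} =>
        (1 - ν₂.valueAtUniformizer v.1 * q v s)⁻¹ * (1 - ν₂.valueAtUniformizer v.1 * q v s)) 1 := by
      have : (fun v : {v : HeightOneSpectrum (𝓞 K) // v ∉ S} =>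
          (1 - ν₂.valueAtUniformizer v.1 * q v s)⁻¹ * (1 - ν₂.valueAtUniformizer v.1 * q v s)) =
          fun _ => 1 := by
        funext v
        have hb : 1 - ν₂.valueAtUniformizer v.1 * q v s ≠ 0 := by
          intro hb
          have hn := congrArg (‖·‖) (sub_eq_zero.mp hb)
          simp only [norm_one] at hn
          rw [HeckeCharacter.norm_valueAtUniformizer_mul_cpow hν₂] at hn
          have : (v.1.residueCard : ℝ) ^ (-s.re) < 1 :=
            Real.rpow_lt_one_of_one_lt_of_neg (by exact_mod_cast v.1.one_lt_residueCard) (by linarith)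
          linarith
        exact inv_mul_cancel₀ hb
      rw [this]; exact hasProd_one
    exact hP.unique h1'
  -- the limits at `s = 1`
  obtain ⟨cν, hcν, hLν_lim⟩ := exists_ne_zero_tendsto_partialHeckeL_of_tate hT ν hν hνA h1 hS hurν
  obtain ⟨cν₂, hcν₂, hLν₂_lim⟩ :=
    exists_ne_zero_tendsto_partialHeckeL_of_tate hT ν₂ hν₂ hν₂A h2 hS hurν₂
  obtain ⟨cZ, hcZ, hZ_lim⟩ := tendsto_sub_one_mul_tprod_eulerFactor_one_numberField (K := K) hS
  haveI := neBot_nhdsWithin_one_lt_re_dih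
  have hmem : ∀ᶠ s : ℂ in 𝓝[{s : ℂ | 1 < s.re}] 1, 1 < s.re := self_mem_nhdsWithin
  -- `M₂ → cν⁻¹`, `M₃ → cν₂⁻¹`
  have hM₂_lim : Tendsto M₂ (𝓝[{s : ℂ | 1 < s.re}] 1) (𝓝 cν⁻¹) := by
    have h' : Tendsto (fun s => (Lν s)⁻¹) (𝓝[{s : ℂ | 1 < s.re}] 1) (𝓝 cν⁻¹) := hLν_lim.inv₀ hcν
    refine h'.congr' ?_
    filter_upwards [hmem] with s hs
    exact (eq_inv_of_mul_eq_one_right (hinvν s hs)).symm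
  have hM₃_lim : Tendsto M₃ (𝓝[{s : ℂ | 1 < s.re}] 1) (𝓝 cν₂⁻¹) := by
    have h' : Tendsto (fun s => (Lν₂ s)⁻¹) (𝓝[{s : ℂ | 1 < s.re}] 1) (𝓝 cν₂⁻¹) := hLν₂_lim.inv₀ hcν₂
    refine h'.congr' ?_
    filter_upwards [hmem] with s hs
    exact (eq_inv_of_mul_eq_one_right (hinvν₂ s hs)).symm
  have hsub1 : Tendsto (fun s : ℂ => s - 1) (𝓝[{s : ℂ | 1 < s.re}] 1) (𝓝 0) := by
    have : Tendsto (fun s : ℂ => s - 1) (𝓝 (1 : ℂ)) (𝓝 (1 - 1)) :=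
      (continuous_id.sub continuous_const).tendsto 1
    rw [sub_self] at this
    exact this.mono_left nhdsWithin_le_nhds
  by_cases h12 : ν * ν₂ = 1
  · -- `L₁ = Z`: `((s-1) Z)² M₂ M₃ = (s-1)²`, limits `cZ² cν⁻¹ cν₂⁻¹ ≠ 0` and `0`
    have hL₁Z : ∀ s, L₁ s = Z s := by
      intro s
      simp only [hL₁, hZ, h12, valueAtUniformizer_one_dih, one_mul]
    have hlimA : Tendsto (fun s : ℂ => ((s - 1) * Z s) * ((s - 1) * Z s) * M₂ s * M₃ s)
        (𝓝[{s : ℂ | 1 < s.re}] 1) (𝓝 (cZ * cZ * cν⁻¹ * cν₂⁻¹)) :=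
      ((hZ_lim.mul hZ_lim).mul hM₂_lim).mul hM₃_lim
    have hlimB : Tendsto (fun s : ℂ => ((s - 1) * Z s) * ((s - 1) * Z s) * M₂ s * M₃ s)
        (𝓝[{s : ℂ | 1 < s.re}] 1) (𝓝 0) := by
      have h0 : Tendsto (fun s : ℂ => (s - 1) * (s - 1)) (𝓝[{s : ℂ | 1 < s.re}] 1) (𝓝 0) := by
        simpa using hsub1.mul hsub1
      refine h0.congr' ?_
      filter_upwards [hmem] with s hs
      have := hprod s hs
      rw [hL₁Z] at this
      linear_combination (-((s - 1) * (s - 1))) * this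
    have := tendsto_nhds_unique hlimA hlimB
    exact (mul_ne_zero (mul_ne_zero (mul_ne_zero hcZ hcZ) (inv_ne_zero hcν)) (inv_ne_zero hcν₂)) this
  · -- `L₁ → c₁ ≠ 0`: `(s-1) · 1 = L₁ M₂ M₃ ((s-1) Z) → c₁ cν⁻¹ cν₂⁻¹ cZ ≠ 0`
    have h12A : ∀ t : ℝ≥0ˣ, (ν * ν₂) (posRealIdele K t) = 1 := fun t => by
      rw [HeckeCharacter.mul_apply, hνA, hν₂A, one_mul]
    obtain ⟨c₁, hc₁, hL₁_lim⟩ :=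
      exists_ne_zero_tendsto_partialHeckeL_of_tate hT (ν * ν₂) h12u h12A h12 hS hur12
    have hlimA : Tendsto (fun s : ℂ => L₁ s * M₂ s * M₃ s * ((s - 1) * Z s))
        (𝓝[{s : ℂ | 1 < s.re}] 1) (𝓝 (c₁ * cν⁻¹ * cν₂⁻¹ * cZ)) :=
      ((hL₁_lim.mul hM₂_lim).mul hM₃_lim).mul hZ_lim
    have hlimB : Tendsto (fun s : ℂ => L₁ s * M₂ s * M₃ s * ((s - 1) * Z s))
        (𝓝[{s : ℂ | 1 < s.re}] 1) (𝓝 0) := by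
      refine hsub1.congr' ?_
      filter_upwards [hmem] with s hs
      have := hprod s hs
      linear_combination (-(s - 1)) * this
    have := tendsto_nhds_unique hlimA hlimB
    exact (mul_ne_zero (mul_ne_zero (mul_ne_zero hc₁ (inv_ne_zero hcν)) (inv_ne_zero hcν₂)) hcZ) this

end Dichotomy



section QuadraticField

variable {F : Type} [Field F] [NumberField F]

/-- **A quadratic Hecke character cuts out a quadratic extension (Frobenius form).** If `δ` is a
Hecke character of `F` with `δ² = 1`, `δ ≠ 1`, there is a Galois quadratic extension `E/F` such
that for almost all finite places `v`: `δ(ϖ_v) = 1` iff `v` splits in `E` (`f_v = 1`). Class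
field theory: `δ = χ ∘ ψ_{L/F}` for a character `χ` of the group of a finite abelian `L ⊆ F̄`
(`HeckeCharacter.exists_eq_charHecke_of_isFiniteOrder`, Tate's Main Theorem in character form),
`χ² = 1 ≠ χ` (the Artin map is onto, `artinIdeleMap_surjective`), `E = L^{ker χ}` has degree
`[Gal(L/F) : ker χ] = 2`, and `δ(ϖ_v) = χ(Frob_v) = 1` iff `Frob_v` fixes `E` iff `Frob_v(E/F) = 1`
iff `f_v(E/F) = 1` (consistency of Frobenii, `restrictNormalHom_galFrob_eq_galFrob_of_isUnramifiedIn`).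
[cite: CasselsFrohlichANT1967, Ch. VII §5.1 Main Theorem (B), (D); §4.2 Corollary (iii)] -/
theorem _root_.Literature.NumberTheory.GaloisRepresentations.HeckeCharacter.exists_quadratic_valueAtUniformizer_eq_one_iff (δ : HeckeCharacter F)
    (h2 : δ ^ 2 = 1) (h1 : δ ≠ 1) :
    ∃ (E : Type) (_ : Field E) (_ : NumberField E) (_ : Algebra F E) (_ : IsGalois F E),
      Module.finrank F E = 2 ∧ ∀ᶠ v : HeightOneSpectrum (𝓞 F) in cofinite,
        (δ.valueAtUniformizer v = 1 ↔ v.asIdeal.inertiaDegIn (𝓞 E) = 1) := by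
  classical
  have hfin : δ.IsFiniteOrder := isOfFinOrder_iff_pow_eq_one.mpr ⟨2, two_pos, h2⟩
  obtain ⟨L, hLfd, hLab, χ, hδ⟩ := δ.exists_eq_charHecke_of_isFiniteOrder hfin
  haveI := hLfd
  haveI := hLab
  haveI : NumberField L := NumberField.of_module_finite F L
  -- `χ ≠ 1`
  have hχ1 : χ ≠ 1 := by
    rintro rfl
    exact h1 (hδ.trans (charHecke_one L artinReciprocity_character_holds))
  -- `χ² = 1`: `ω_{χ²} = ω_χ² = δ² = 1` and the Artin map is onto
  have hχ2 : χ ^ 2 = 1 := by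
    have hc : charHecke L (χ ^ 2) artinReciprocity_character_holds = 1 := by
      have := map_pow (charHeckeHom L artinReciprocity_character_holds) χ 2
      rw [charHeckeHom_apply, charHeckeHom_apply] at this
      rw [this, ← hδ, h2]
    refine MonoidHom.ext fun g => ?_
    obtain ⟨x, rfl⟩ := artinIdeleMap_surjective L artinReciprocity_character_holds g
    rw [apply_artinIdeleMap, hc, MonoidHom.one_apply, HeckeCharacter.one_apply]
  have hχval : ∀ g, χ g = 1 ∨ χ g = -1 := fun g => by
    have h : ((χ g : ℂˣ) : ℂ) * ((χ g : ℂˣ) : ℂ) = 1 := by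
      rw [← Units.val_mul, ← sq, ← MonoidHom.pow_apply, hχ2, MonoidHom.one_apply, Units.val_one]
    rcases mul_self_eq_one_iff.mp h with h' | h'
    · exact Or.inl (Units.ext h')
    · exact Or.inr (Units.ext (by rw [h', Units.val_neg, Units.val_one]))
  -- the quadratic field `E₀ = L^{ker χ}`
  set H : Subgroup (L ≃ₐ[F] L) := χ.ker with hHdef
  set E₀ : IntermediateField F L := IntermediateField.fixedField H with hE₀def
  haveI : H.Normal := MonoidHom.normal_ker χ
  haveI : IsGalois F E₀ := IsGalois.of_fixedField_normal_subgroup H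
  haveI : NumberField E₀ := NumberField.of_module_finite F E₀
  -- `[E₀ : F] = [Gal(L/F) : ker χ] = 2`
  obtain ⟨a, ha⟩ : ∃ a, χ a ≠ 1 := by
    by_contra hall
    push Not at hall
    exact hχ1 (MonoidHom.ext hall)
  have hidx : H.index = 2 := by
    refine Subgroup.index_eq_two_iff.mpr ⟨a, fun b => ?_⟩
    have ha' : χ a = -1 := (hχval a).resolve_left ha
    simp only [hHdef, MonoidHom.mem_ker, map_mul, ha']
    rcases hχval b with hb | hb
    · rw [hb]
      right
      exact ⟨rfl, fun h => by norm_num at h⟩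
    · rw [hb]
      left
      exact ⟨by norm_num, fun h => by norm_num at h⟩
  have hdeg : Module.finrank F E₀ = 2 := by
    have h1' : Module.finrank F E₀ * Module.finrank E₀ L = Module.finrank F L :=
      Module.finrank_mul_finrank F E₀ L
    have h2' : Module.finrank E₀ L = Nat.card H := by
      rw [hE₀def, IntermediateField.finrank_fixedField_eq_card]
    have h3' : Nat.card H * H.index = Nat.card (L ≃ₐ[F] L) := Subgroup.card_mul_index H
    have h4' : Nat.card (L ≃ₐ[F] L) = Module.finrank F L := IsGalois.card_aut_eq_finrank F L
    have hH0 : 0 < Nat.card H := Nat.card_pos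
    rw [h2'] at h1'
    rw [hidx, h4', ← h1'] at h3'
    -- `card H * 2 = finrank F E₀ * card H`
    have : Module.finrank F E₀ * Nat.card H = 2 * Nat.card H := by linarith
    exact Nat.eq_of_mul_eq_mul_right hH0 this
  -- commutativity downstairs
  have hcommL : ∀ a b : L ≃ₐ[F] L, Commute a b := commute_of_isAbelianGalois L
  have hcommE : ∀ a b : E₀ ≃ₐ[F] E₀, Commute a b := by
    intro a b
    obtain ⟨a', rfl⟩ := AlgEquiv.restrictNormalHom_surjective L a
    obtain ⟨b', rfl⟩ := AlgEquiv.restrictNormalHom_surjective L b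
    rw [Commute, SemiconjBy, ← map_mul, ← map_mul, (hcommL a' b').eq]
  -- Frobenius bookkeeping at almost all `v`
  have hunrL : ∀ᶠ v : HeightOneSpectrum (𝓞 F) in cofinite,
      Algebra.IsUnramifiedIn (𝓞 L) v.asIdeal := eventually_isUnramifiedIn L
  have hunrE : ∀ᶠ v : HeightOneSpectrum (𝓞 F) in cofinite,
      Algebra.IsUnramifiedIn (𝓞 E₀) v.asIdeal := by
    rw [eventually_cofinite]
    exact finite_setOf_not_isUnramifiedIn F E₀
  refine ⟨E₀, inferInstance, inferInstance, inferInstance, inferInstance, hdeg, ?_⟩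
  filter_upwards [hunrL, hunrE] with v hvL hvE
  have hval : δ.valueAtUniformizer v = ((χ (galFrob F L v) : ℂˣ) : ℂ) := by
    rw [hδ]
    exact charHecke_valueAtUniformizer L χ artinReciprocity_character_holds hvL
  have hres : AlgEquiv.restrictNormalHom E₀ (galFrob F L v) = galFrob F E₀ v :=
    restrictNormalHom_galFrob_eq_galFrob_of_isUnramifiedIn hcommE hvE
  have hker : χ (galFrob F L v) = 1 ↔ galFrob F E₀ v = 1 := by
    rw [← hres, ← MonoidHom.mem_ker, ← hHdef]
    have hH : H = E₀.fixingSubgroup := by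
      rw [hE₀def, IntermediateField.fixingSubgroup_fixedField]
    rw [hH, ← IntermediateField.restrictNormalHom_ker, MonoidHom.mem_ker]
  rw [hval, Units.val_eq_one, hker]
  constructor
  · exact inertiaDegIn_eq_one_of_galFrob_eq_one
  · intro hf
    have h := galFrob_pow_inertiaDegIn_eq_one (F := F) (L := E₀) hvE
    rwa [hf, pow_one] at h

/-- **A quadratic Hecke character is the class-field character of a quadratic extension.** If
`δ² = 1 ≠ δ` then there is a Galois quadratic extension `E/F` with `δ` vanishing exactly on
`F^× N(𝔸_E^×)` (`IsClassFieldCharacter`): with `E` from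
`HeckeCharacter.exists_quadratic_valueAtUniformizer_eq_one_iff` and `η` the class-field character of
`E/F` (`exists_isClassFieldCharacter_holds`), both `δ(ϖ_v)` and `η(ϖ_v)` are `1` at the split and
`-1` at the inert places, for almost all `v` (`IsClassFieldCharacter.eventually_isPrimitiveRoot_valueAtUniformizer`),
so `δ = η` by rigidity (`HeckeCharacter.ext_of_eventually_valueAtUniformizer_eq`).
[cite: CasselsFrohlichANT1967, Ch. VII §5.1 Main Theorem (B), (D)] -/
theorem _root_.Literature.NumberTheory.GaloisRepresentations.HeckeCharacter.exists_isClassFieldCharacter_of_sq_eq_one (δ : HeckeCharacter F)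
    (h2 : δ ^ 2 = 1) (h1 : δ ≠ 1) :
    ∃ (E : Type) (_ : Field E) (_ : NumberField E) (_ : Algebra F E) (_ : IsGalois F E),
      Module.finrank F E = 2 ∧ δ.IsClassFieldCharacter E := by
  obtain ⟨E, _, _, _, _, hdeg, hv⟩ := δ.exists_quadratic_valueAtUniformizer_eq_one_iff h2 h1
  haveI : FiniteDimensional F E := Module.finite_of_finrank_pos (by rw [hdeg]; exact two_pos)
  have hprime : (Module.finrank F E).Prime := by rw [hdeg]; exact Nat.prime_two
  haveI : IsCyclic (E ≃ₐ[F] E) := by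
    haveI : Fact (Module.finrank F E).Prime := ⟨hprime⟩
    exact isCyclic_of_prime_card (IsGalois.card_aut_eq_finrank F E)
  obtain ⟨η, hη, hηord⟩ : ∃ η : HeckeCharacter F,
      η.IsClassFieldCharacter E ∧ orderOf η = Module.finrank F E :=
    exists_isClassFieldCharacter_holds (F := F) (E := E)
  refine ⟨E, inferInstance, inferInstance, inferInstance, inferInstance, hdeg, ?_⟩
  suffices hδη : δ = η by rw [hδη]; exact hη
  refine HeckeCharacter.ext_of_eventually_valueAtUniformizer_eq ?_
  have hη2 : η ^ 2 = 1 := by rw [← hdeg, ← hηord]; exact pow_orderOf_eq_one η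
  have hsq : ∀ (ω : HeckeCharacter F), ω ^ 2 = 1 → ∀ v : HeightOneSpectrum (𝓞 F),
      ω.valueAtUniformizer v = 1 ∨ ω.valueAtUniformizer v = -1 := by
    intro ω hω v
    have h : ω.valueAtUniformizer v * ω.valueAtUniformizer v = 1 := by
      have := congrArg (fun ω : HeckeCharacter F => ω.valueAtUniformizer v) hω
      simpa only [sq, HeckeCharacter.valueAtUniformizer, HeckeCharacter.localComponent_apply,
        HeckeCharacter.mul_apply, HeckeCharacter.one_apply, Units.val_mul, Units.val_one] using this
    exact mul_self_eq_one_iff.mp h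
  filter_upwards [hv, hη.eventually_isPrimitiveRoot_valueAtUniformizer hprime] with v hδv hηv
  by_cases hf : v.asIdeal.inertiaDegIn (𝓞 E) = 1
  · rw [hδv.mpr hf]
    rw [hf] at hηv
    exact (IsPrimitiveRoot.one_right_iff.mp hηv).symm
  · have hδ' : δ.valueAtUniformizer v = -1 := (hsq δ h2 v).resolve_left fun h => hf (hδv.mp h)
    have hη' : η.valueAtUniformizer v = -1 := by
      refine (hsq η hη2 v).resolve_left fun h => hf ?_
      rw [h] at hηv
      exact (IsPrimitiveRoot.one_left_iff).mp hηv
    rw [hδ', hη']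

end QuadraticField



/-! ### Helpers: two-element multisets, quadratic Galois groups, base change at uniformizers -/

section Helpers

/-- `{a, b} = {c, d}` as multisets iff `(a, b) = (c, d)` or `(a, b) = (d, c)`. [folklore] -/
private theorem pair_eq_pair_iff_dih {a b c d : ℂ} :
    ({a} + {b} : Multiset ℂ) = {c} + {d} ↔ (a = c ∧ b = d) ∨ (a = d ∧ b = c) := by
  rw [Multiset.singleton_add, Multiset.singleton_add, Multiset.cons_eq_cons]
  simp only [Multiset.singleton_inj, Multiset.singleton_eq_cons_iff]
  constructor
  · rintro (⟨h1, h2⟩ | ⟨-, cs, ⟨h1, -⟩, ⟨h3, -⟩⟩)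
    · exact Or.inl ⟨h1, h2⟩
    · exact Or.inr ⟨h3.symm, h1⟩
  · rintro (⟨h1, h2⟩ | ⟨h1, h2⟩)
    · exact Or.inl ⟨h1, h2⟩
    · by_cases hac : a = c
      · exact Or.inl ⟨hac, by rw [h2, ← hac, h1]⟩
      · exact Or.inr ⟨hac, 0, ⟨h2, rfl⟩, ⟨h1.symm, rfl⟩⟩

/-- `({a} + {b}).map f = {f a} + {f b}`. [folklore] -/
private theorem map_pair_dih (a b : ℂ) (f : ℂ → ℂ) :
    (({a} + {b} : Multiset ℂ)).map f = {f a} + {f b} := by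
  rw [Multiset.map_add, Multiset.map_singleton, Multiset.map_singleton]

/-- A two-element multiset stable under `x ↦ -x` whose entrywise square is `{a, b}` with
`a, b ≠ 0` is `{x, -x}` with `x² = a = b`. [folklore] -/
private theorem sq_of_neg_stable_dih {α : Multiset ℂ} {a b : ℂ} (ha : a ≠ 0) (hb : b ≠ 0)
    (hsq : ({a} + {b} : Multiset ℂ) = α.map (· ^ 2)) (hneg : α.map (fun x => -x) = α) :
    b = a ∧ ∃ x : ℂ, x ^ 2 = a ∧ α = {x} + {-x} := by
  have hcard : Multiset.card α = 2 := by
    have := congrArg Multiset.card hsq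
    rw [Multiset.card_map, Multiset.card_add, Multiset.card_singleton, Multiset.card_singleton] at this
    omega
  obtain ⟨x, y, rfl⟩ := Multiset.card_eq_two.mp hcard
  have hxy : ({x, y} : Multiset ℂ) = {x} + {y} := by
    rw [Multiset.singleton_add, Multiset.insert_eq_cons]
  rw [hxy] at hsq hneg ⊢
  rw [map_pair_dih] at hsq hneg
  have hx0 : x ≠ 0 := by
    rintro rfl
    rcases pair_eq_pair_iff_dih.mp hsq with ⟨h1, -⟩ | ⟨-, h1⟩
    · exact ha (by rw [h1]; ring)
    · exact hb (by rw [h1]; ring)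
  have hyx : y = -x := by
    rcases pair_eq_pair_iff_dih.mp hneg with ⟨h1, -⟩ | ⟨h1, -⟩
    · exfalso
      apply hx0
      have h2 : (2 : ℂ) * x = 0 := by linear_combination -h1
      rcases mul_eq_zero.mp h2 with h | h
      · norm_num at h
      · exact h
    · exact h1.symm
  subst hyx
  have hsq' : ({a} + {b} : Multiset ℂ) = {x ^ 2} + {x ^ 2} := by
    rw [hsq]; congr 1; rw [Multiset.singleton_inj]; ring
  rcases pair_eq_pair_iff_dih.mp hsq' with ⟨h1, h2⟩ | ⟨h1, h2⟩
  · exact ⟨by rw [h1, h2], x, h1.symm, rfl⟩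
  · exact ⟨by rw [h1, h2], x, h1.symm, rfl⟩

variable {F E : Type} [Field F] [NumberField F] [Field E] [NumberField E] [Algebra F E]

/-- In a quadratic Galois extension, `Gal(E/F) = {1, σ}` for any `σ ≠ 1`. [folklore] -/
private theorem gal_eq_one_or_eq_dih [IsGalois F E] (h2 : Module.finrank F E = 2)
    {σ : E ≃ₐ[F] E} (hσ : σ ≠ 1) (τ : E ≃ₐ[F] E) : τ = 1 ∨ τ = σ := by
  haveI : FiniteDimensional F E := Module.finite_of_finrank_pos (by rw [h2]; exact two_pos)
  have hcard : Nat.card (E ≃ₐ[F] E) = 2 := by rw [IsGalois.card_aut_eq_finrank, h2]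
  obtain ⟨x, y, -, huniv⟩ := Nat.card_eq_two_iff.mp hcard
  have hmem : ∀ z : E ≃ₐ[F] E, z = x ∨ z = y := fun z => by
    have hz : z ∈ ({x, y} : Set (E ≃ₐ[F] E)) := by rw [huniv]; exact Set.mem_univ z
    simpa using hz
  rcases hmem τ with hτ | hτ <;> rcases hmem σ with hs | hs <;>
    rcases hmem (1 : E ≃ₐ[F] E) with h1 | h1 <;>
    first
      | exact Or.inl (hτ.trans h1.symm)
      | exact Or.inr (hτ.trans hs.symm)
      | exact absurd (hs.trans h1.symm) hσ

/-- In a quadratic Galois extension, `σ⁻¹ = σ`. [folklore] -/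
private theorem gal_inv_eq_self_dih [IsGalois F E] (h2 : Module.finrank F E = 2)
    (σ : E ≃ₐ[F] E) : σ⁻¹ = σ := by
  haveI : FiniteDimensional F E := Module.finite_of_finrank_pos (by rw [h2]; exact two_pos)
  have hcard : Nat.card (E ≃ₐ[F] E) = 2 := by rw [IsGalois.card_aut_eq_finrank, h2]
  have hsq : σ ^ 2 = 1 := by rw [← hcard]; exact pow_card_eq_one'
  rw [inv_eq_iff_mul_eq_one, ← sq, hsq]

/-- **Base change at uniformizers**: for a Hecke character `χ` of `F` and almost all places `w` of
the Galois extension `E`, `(χ ∘ N_{E/F})(ϖ_w) = χ(ϖ_v)^{f(w|v)}`, `v = w ∩ 𝓞 F`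
(`HeckeCharacter.baseChange_localUnits`: `N_{E/F}(⟨ϖ_v⟩_w) = ⟨ϖ_v⟩_v^{e f}`, with `e = 1` and the
image of `ϖ_v` a uniformizer at `w` for almost all `w`). [cite: ArthurClozelAMS120, Ch. 3, §1 (1.1)] -/
theorem _root_.Literature.NumberTheory.GaloisRepresentations.HeckeCharacter.eventually_valueAtUniformizer_baseChange [IsGalois F E] (χ : HeckeCharacter F) :
    ∀ᶠ w : HeightOneSpectrum (𝓞 E) in cofinite,
      (χ.baseChange E).valueAtUniformizer w =
        χ.valueAtUniformizer (w.under (𝓞 F)) ^ w.asIdeal.inertiaDeg (𝓞 F) := by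
  have ha : ∀ᶠ w : HeightOneSpectrum (𝓞 E) in cofinite, (χ.baseChange E).IsUnramifiedAt w :=
    HeckeCharacter.isUnramifiedAt_cofinite_holds _
  filter_upwards [ha, eventually_ramificationIdx_eq_one F E] with w hunrE hw4
  haveI iw : w.asIdeal.LiesOver (w.under (𝓞 F)).asIdeal := ⟨rfl⟩
  obtain ⟨c, hc, -⟩ := exists_localUnitsAbove E (w.under (𝓞 F))
    (HeckeCharacter.uniformizer F (w.under (𝓞 F)))
  have he' : (w.under (𝓞 F)).asIdeal.ramificationIdx' w.asIdeal = 1 := by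
    rw [Ideal.ramificationIdx'_eq_ramificationIdx (w.under (𝓞 F)).asIdeal w.asIdeal
      (w.under (𝓞 F)).ne_bot, hw4]
  have heIn : (w.under (𝓞 F)).asIdeal.ramificationIdxIn (𝓞 E) = 1 := by
    rw [Ideal.ramificationIdxIn_eq_ramificationIdx (w.under (𝓞 F)).asIdeal w.asIdeal (E ≃ₐ[F] E),
      hw4]
  have hfIn : (w.under (𝓞 F)).asIdeal.inertiaDegIn (𝓞 E) = w.asIdeal.inertiaDeg (𝓞 F) :=
    Ideal.inertiaDegIn_eq_inertiaDeg (w.under (𝓞 F)).asIdeal w.asIdeal (E ≃ₐ[F] E)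
  have hϖ' : Valued.v ((c w : (w.adicCompletion E)ˣ) : w.adicCompletion E) =
      WithZero.exp (-1 : ℤ) := by
    rw [hc w rfl, valued_adicCompletionOfLiesOver, he', pow_one, HeckeCharacter.valued_uniformizer]
  rw [← HeckeCharacter.localComponent_eq_valueAtUniformizer hunrE hϖ',
    HeckeCharacter.localComponent_apply,
    HeckeCharacter.baseChange_localUnits E _ (w.under (𝓞 F)) (HeckeCharacter.uniformizer F _) c hc
      rfl, heIn, one_mul, hfIn, Units.val_pow_eq_pow_val]
  rfl

end Helpers

/-! ### The model-free core of the dihedral case (op. cit. p. 38) -/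

section Core

variable {F E : Type} [Field F] [NumberField F] [Field E] [NumberField E] [Algebra F E]

/-- **The dihedral case of Thm. 4.1.2 at the level of the inducing characters** (Ramakrishnan,
op. cit. p. 38: "`π = I_K^F(μ)`, `π' = I_K^F(μ')` … `{μ/(μ∘θ), (μ∘θ)/μ} = {μ'/(μ'∘θ), (μ'∘θ)/μ'}`
… there exists an idele class character `χ` of `F` with `μ' = μ · χ_K` … `π' ≅ I_K^F(μ) ⊗ χ ≅ π ⊗ χ`").
Data: `E/F` Galois quadratic with `σ ≠ 1`; unitary Hecke characters `μ, μ^σ, μ', μ'^σ` of `E`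
trivial on `A_G` (`μ^σ(x) = μ(σ⁻¹ x)`); families `A, A'` of multisets indexed by the finite places
of `F` with `A' = c · A` almost everywhere (hypothesis `(LL)`), `-A(v) = A(v)` at the inert `v`
(the self-twist by `η_{E/F}`), and the automorphic-induction relation
`{μ(ϖ_w)} + {μ^σ(ϖ_w)} = A(v)^{f(w|v)}` (and likewise for `μ'`, `A'`) at almost all `w ∣ v`.
Conclusion: `A'(v) = χ(ϖ_v) A(v)` for almost all `v`, for some Hecke character `χ` of `F`.
Proof: at a split `w`, `{μ'_w, μ'^σ_w} = c {μ_w, μ^σ_w}` gives `ν(ϖ_w) = 1` or `ν₂(ϖ_w) = 1` for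
`ν = (μ'/μ)/(μ'/μ)^σ`, `ν₂ = (μ'/μ^σ)/(μ'/μ^σ)^σ`; at an inert `w` both hold (`A(v) = {x, -x}`, so
`μ_w = μ^σ_w = x²`); hence `ν = 1` or `ν₂ = 1`
(`HeckeCharacter.eq_one_or_eq_one_of_eventually_valueAtUniformizer`, from Tate's theorem `hT`),
i.e. `μ'/μ` or `μ'/μ^σ` is `Gal(E/F)`-invariant, hence a base change `χ ∘ N_{E/F}`
(`HeckeCharacter.exists_baseChange_eq_of_forall_smul_eq`, Hilbert 90 for idele classes); and then
`A'(v) = χ(ϖ_v) A(v)` by the induction relation and `(χ ∘ N)(ϖ_w) = χ(ϖ_v)^{f}`.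
[cite: Ramakrishnan2000, §4.1, proof of Thm. 4.1.2 (p. 38)] -/
theorem Ramakrishnan2000_dihedral_core [IsGalois F E] (h2 : Module.finrank F E = 2)
    (hT : ∀ χ : HeckeCharacter E, heckeLFunction_hasEntireContinuation_of_not_isNormTwist χ)
    {σ : E ≃ₐ[F] E} (hσ : σ ≠ 1)
    {μ μσ μ' μ'σ : HeckeCharacter E} (hμσ : ∀ x, μσ x = μ (σ⁻¹ • x))
    (hμ'σ : ∀ x, μ'σ x = μ' (σ⁻¹ • x))
    (hu : μ.IsUnitary) (hu' : μ'.IsUnitary) (huσ : μσ.IsUnitary) (hu'σ : μ'σ.IsUnitary)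
    (hA : ∀ t, μ (posRealIdele E t) = 1) (hA' : ∀ t, μ' (posRealIdele E t) = 1)
    (hAσ : ∀ t, μσ (posRealIdele E t) = 1) (hA'σ : ∀ t, μ'σ (posRealIdele E t) = 1)
    {A A' : HeightOneSpectrum (𝓞 F) → Multiset ℂ}
    (hLL : ∀ᶠ v : HeightOneSpectrum (𝓞 F) in cofinite, ∃ c : ℂ, c ≠ 0 ∧ A' v = (A v).map (c * ·))
    (hst : ∀ᶠ w : HeightOneSpectrum (𝓞 E) in cofinite, w.asIdeal.inertiaDeg (𝓞 F) = 2 →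
      (A (w.under (𝓞 F))).map (fun x => -x) = A (w.under (𝓞 F)))
    (hrel : ∀ᶠ w : HeightOneSpectrum (𝓞 E) in cofinite,
      ({μ.valueAtUniformizer w} + {μσ.valueAtUniformizer w} : Multiset ℂ) =
        (A (w.under (𝓞 F))).map (· ^ w.asIdeal.inertiaDeg (𝓞 F)))
    (hrel' : ∀ᶠ w : HeightOneSpectrum (𝓞 E) in cofinite,
      ({μ'.valueAtUniformizer w} + {μ'σ.valueAtUniformizer w} : Multiset ℂ) =
        (A' (w.under (𝓞 F))).map (· ^ w.asIdeal.inertiaDeg (𝓞 F))) :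
    ∃ χ : HeckeCharacter F, ∀ᶠ v : HeightOneSpectrum (𝓞 F) in cofinite,
      A' v = (A v).map (χ.valueAtUniformizer v * ·) := by
  classical
  haveI : FiniteDimensional F E := Module.finite_of_finrank_pos (by rw [h2]; exact two_pos)
  have hprime : (Module.finrank F E).Prime := by rw [h2]; exact Nat.prime_two
  have hσinv : σ⁻¹ = σ := gal_inv_eq_self_dih h2 σ
  -- values at uniformizers
  have vmul : ∀ (χ ψ : HeckeCharacter E) (w : HeightOneSpectrum (𝓞 E)),
      (χ * ψ).valueAtUniformizer w = χ.valueAtUniformizer w * ψ.valueAtUniformizer w :=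
    fun χ ψ w => HeckeCharacter.valueAtUniformizer_mul χ ψ w
  have vinv : ∀ (χ : HeckeCharacter E) (w : HeightOneSpectrum (𝓞 E)),
      χ⁻¹.valueAtUniformizer w = (χ.valueAtUniformizer w)⁻¹ := fun χ w => by
    simp only [HeckeCharacter.valueAtUniformizer, HeckeCharacter.localComponent_apply,
      HeckeCharacter.inv_apply, Units.val_inv_eq_inv_val]
  have vne : ∀ (χ : HeckeCharacter E) (w : HeightOneSpectrum (𝓞 E)), χ.valueAtUniformizer w ≠ 0 :=
    fun χ w => by
      simp only [HeckeCharacter.valueAtUniformizer, HeckeCharacter.localComponent_apply]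
      exact Units.ne_zero _
  -- the two characters of the dichotomy
  set ν : HeckeCharacter E := μ' * μ⁻¹ * (μ'σ * μσ⁻¹)⁻¹ with hνdef
  set ν₂ : HeckeCharacter E := μ' * μσ⁻¹ * (μ'σ * μ⁻¹)⁻¹ with hν₂def
  have hνu : ν.IsUnitary := (hu'.mul hu.inv).mul (hu'σ.mul huσ.inv).inv
  have hν₂u : ν₂.IsUnitary := (hu'.mul huσ.inv).mul (hu'σ.mul hu.inv).inv
  have hνA : ∀ t, ν (posRealIdele E t) = 1 := fun t => by
    simp only [hνdef, HeckeCharacter.mul_apply, HeckeCharacter.inv_apply, hA, hA', hAσ, hA'σ,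
      inv_one, mul_one]
  have hν₂A : ∀ t, ν₂ (posRealIdele E t) = 1 := fun t => by
    simp only [hν₂def, HeckeCharacter.mul_apply, HeckeCharacter.inv_apply, hA, hA', hAσ, hA'σ,
      inv_one, mul_one]
  have hνw : ∀ w, ν.valueAtUniformizer w = μ'.valueAtUniformizer w * (μ.valueAtUniformizer w)⁻¹ *
      (μ'σ.valueAtUniformizer w * (μσ.valueAtUniformizer w)⁻¹)⁻¹ := fun w => by
    simp only [hνdef, vmul, vinv]
  have hν₂w : ∀ w, ν₂.valueAtUniformizer w = μ'.valueAtUniformizer w * (μσ.valueAtUniformizer w)⁻¹ *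
      (μ'σ.valueAtUniformizer w * (μ.valueAtUniformizer w)⁻¹)⁻¹ := fun w => by
    simp only [hν₂def, vmul, vinv]
  -- `(LL)` read at the places of `E`; `-A' = A'` at the inert places
  have hLLw : ∀ᶠ w : HeightOneSpectrum (𝓞 E) in cofinite,
      ∃ c : ℂ, c ≠ 0 ∧ A' (w.under (𝓞 F)) = (A (w.under (𝓞 F))).map (c * ·) :=
    (tendsto_under_cofinite (𝓞 F)).eventually hLL
  have hneg_of : ∀ {α : Multiset ℂ} {c : ℂ}, α.map (fun x => -x) = α →
      (α.map (c * ·)).map (fun x => -x) = α.map (c * ·) := by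
    intro α c hα
    calc (α.map (c * ·)).map (fun x => -x) = α.map (fun y => -(c * y)) := by
          rw [Multiset.map_map]; rfl
      _ = (α.map (fun x => -x)).map (c * ·) := by
          rw [Multiset.map_map]
          exact Multiset.map_congr rfl fun y _ => by simp only [Function.comp_apply]; ring
      _ = α.map (c * ·) := by rw [hα]
  have hf12 : ∀ w : HeightOneSpectrum (𝓞 E),
      w.asIdeal.inertiaDeg (𝓞 F) = 1 ∨ w.asIdeal.inertiaDeg (𝓞 F) = 2 := fun w =>
    inertiaDeg_eq_one_or_two_of_finrank_eq_two h2 (w.under (𝓞 F)) w rfl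
  -- pointwise: `ν(ϖ_w) = 1 ∨ ν₂(ϖ_w) = 1`
  have hpt : ∀ᶠ w : HeightOneSpectrum (𝓞 E) in cofinite,
      ν.valueAtUniformizer w = 1 ∨ ν₂.valueAtUniformizer w = 1 := by
    filter_upwards [hLLw, hst, hrel, hrel'] with w hc hstw hrw hrw'
    obtain ⟨c, hc0, hcA⟩ := hc
    have ha0 := vne μ w
    have hb0 := vne μσ w
    have ha0' := vne μ' w
    have hb0' := vne μ'σ w
    rcases hf12 w with hf | hf
    · -- split: `{a', b'} = c {a, b}`
      rw [hf] at hrw hrw'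
      simp only [pow_one, Multiset.map_id'] at hrw hrw'
      rw [hcA, ← hrw, map_pair_dih] at hrw'
      rcases pair_eq_pair_iff_dih.mp hrw' with ⟨h1, h2'⟩ | ⟨h1, h2'⟩
      · left
        rw [hνw, h1, h2']
        field_simp
      · right
        rw [hν₂w, h1, h2']
        field_simp
    · -- inert: `A(v) = {x, -x}`, `μ_w = μ^σ_w = x²`, `μ'_w = μ'^σ_w`
      rw [hf] at hrw hrw'
      have hstv := hstw hf
      obtain ⟨hba, -⟩ := sq_of_neg_stable_dih ha0 hb0 hrw hstv
      have hstv' : (A' (w.under (𝓞 F))).map (fun x => -x) = A' (w.under (𝓞 F)) := by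
        rw [hcA]; exact hneg_of hstv
      obtain ⟨hba', -⟩ := sq_of_neg_stable_dih ha0' hb0' hrw' hstv'
      left
      rw [hνw, hba, hba']
      field_simp
  -- the dichotomy: `ν = 1` or `ν₂ = 1`
  have hdich :=
    HeckeCharacter.eq_one_or_eq_one_of_eventually_valueAtUniformizer hT hνu hν₂u hνA hν₂A hpt
  have hgal : ∀ τ : E ≃ₐ[F] E, τ = 1 ∨ τ = σ := gal_eq_one_or_eq_dih h2 hσ
  -- descent of `μ'/μ` (case `ν = 1`) or of `μ'/μ^σ` (case `ν₂ = 1`)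
  obtain ⟨χ, hχ⟩ : ∃ χ : HeckeCharacter F,
      (ν = 1 ∧ χ.baseChange E = μ' * μ⁻¹) ∨ (ν₂ = 1 ∧ χ.baseChange E = μ' * μσ⁻¹) := by
    rcases hdich with h1 | h1
    · have hinv : ∀ (τ : E ≃ₐ[F] E) (y : ideleGroup E), (μ' * μ⁻¹) (τ • y) = (μ' * μ⁻¹) y := by
        intro τ y
        rcases hgal τ with hτ | hτ
        · rw [hτ, one_smul]
        · rw [hτ]
          have hy := congrArg (fun χ : HeckeCharacter E => χ (σ • y)) h1
          simp only [hνdef, HeckeCharacter.mul_apply, HeckeCharacter.inv_apply,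
            HeckeCharacter.one_apply, hμσ, hμ'σ, inv_smul_smul] at hy
          rw [HeckeCharacter.mul_apply, HeckeCharacter.inv_apply, HeckeCharacter.mul_apply,
            HeckeCharacter.inv_apply]
          exact mul_inv_eq_one.mp hy
      obtain ⟨χ, hχ⟩ :=
        HeckeCharacter.exists_baseChange_eq_of_forall_smul_eq hprime (μ' * μ⁻¹) hinv
      exact ⟨χ, Or.inl ⟨h1, hχ⟩⟩
    · have hinv : ∀ (τ : E ≃ₐ[F] E) (y : ideleGroup E), (μ' * μσ⁻¹) (τ • y) = (μ' * μσ⁻¹) y := by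
        intro τ y
        rcases hgal τ with hτ | hτ
        · rw [hτ, one_smul]
        · rw [hτ]
          have hy := congrArg (fun χ : HeckeCharacter E => χ (σ • y)) h1
          simp only [hν₂def, HeckeCharacter.mul_apply, HeckeCharacter.inv_apply,
            HeckeCharacter.one_apply, hμσ, hμ'σ, inv_smul_smul] at hy
          rw [HeckeCharacter.mul_apply, HeckeCharacter.inv_apply, HeckeCharacter.mul_apply,
            HeckeCharacter.inv_apply, hμσ, hμσ, inv_smul_smul, hσinv]
          exact mul_inv_eq_one.mp hy
      obtain ⟨χ, hχ⟩ :=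
        HeckeCharacter.exists_baseChange_eq_of_forall_smul_eq hprime (μ' * μσ⁻¹) hinv
      exact ⟨χ, Or.inr ⟨h1, hχ⟩⟩
  refine ⟨χ, ?_⟩
  -- conclusion at almost all `v`, through a place `w ∣ v`
  have hbc := χ.eventually_valueAtUniformizer_baseChange (E := E)
  have hgood := eventually_forall_under_eq (F := F)
    ((((hLLw.and hst).and hrel).and hrel').and hbc)
  filter_upwards [hgood, hLL] with v hv hcv
  obtain ⟨c, hc0, hcA⟩ := hcv
  obtain ⟨w, hw⟩ := exists_above (E := E) v
  have hwv : w.under (𝓞 F) = v := HeightOneSpectrum.ext hw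
  obtain ⟨⟨⟨⟨-, hstw⟩, hrw⟩, hrw'⟩, hbcw⟩ := hv w hw
  rw [hwv] at hstw hrw hrw' hbcw
  have ha0 := vne μ w
  have hb0 := vne μσ w
  have ha0' := vne μ' w
  have hb0' := vne μ'σ w
  rcases hf12 w with hf | hf
  · -- split place: `f(w|v) = 1`
    rw [hf, pow_one] at hbcw
    rw [hf] at hrw hrw'
    simp only [pow_one, Multiset.map_id'] at hrw hrw'
    rw [← hrw', ← hrw, map_pair_dih]
    rcases hχ with ⟨hν1, hχE⟩ | ⟨hν1, hχE⟩
    · -- `μ' = (χ ∘ N) μ`; `ν = 1` at `w`: `μ'^σ_w/μ^σ_w = μ'_w/μ_w`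
      rw [hχE, vmul, vinv] at hbcw
      have h3 : ν.valueAtUniformizer w = 1 := by rw [hν1]; exact valueAtUniformizer_one_dih w
      rw [hνw, mul_inv_eq_one₀ (mul_ne_zero hb0' (inv_ne_zero hb0)), hbcw] at h3
      -- `hbcw : a'/a = χ(ϖ_v)`, `h3 : χ(ϖ_v) = b'/b`
      have h1 := (mul_inv_eq_iff_eq_mul₀ ha0).mp hbcw
      have h2' := (mul_inv_eq_iff_eq_mul₀ hb0).mp h3.symm
      rw [h1, h2']
    · -- `μ' = (χ ∘ N) μ^σ`; `ν₂ = 1` at `w`: `μ'^σ_w/μ_w = μ'_w/μ^σ_w`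
      rw [hχE, vmul, vinv] at hbcw
      have h3 : ν₂.valueAtUniformizer w = 1 := by rw [hν1]; exact valueAtUniformizer_one_dih w
      rw [hν₂w, mul_inv_eq_one₀ (mul_ne_zero hb0' (inv_ne_zero ha0)), hbcw] at h3
      have h1 := (mul_inv_eq_iff_eq_mul₀ hb0).mp hbcw
      have h2' := (mul_inv_eq_iff_eq_mul₀ ha0).mp h3.symm
      rw [h1, h2', add_comm]
  · -- inert place: `A v = {x, -x}`, `A' v = {x', -x'}`, `μ_w = x²`, `μ'_w = x'² = χ(ϖ_v)² μ_w`
    rw [hf] at hbcw hrw hrw'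
    have hstv := hstw hf
    obtain ⟨hba, x, hxa, hAx⟩ := sq_of_neg_stable_dih ha0 hb0 hrw hstv
    have hstv' : (A' v).map (fun x => -x) = A' v := by rw [hcA]; exact hneg_of hstv
    obtain ⟨-, x', hxa', hAx'⟩ := sq_of_neg_stable_dih ha0' hb0' hrw' hstv'
    have hkey : μ'.valueAtUniformizer w = χ.valueAtUniformizer v ^ 2 * μ.valueAtUniformizer w := by
      rcases hχ with ⟨-, hχE⟩ | ⟨-, hχE⟩
      · rw [hχE, vmul, vinv] at hbcw
        rw [← (mul_inv_eq_iff_eq_mul₀ ha0).mp hbcw]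
      · rw [hχE, vmul, vinv, hba] at hbcw
        rw [← (mul_inv_eq_iff_eq_mul₀ ha0).mp hbcw]
    rw [hAx, hAx', map_pair_dih]
    have hsq : x' ^ 2 = (χ.valueAtUniformizer v * x) ^ 2 := by
      rw [mul_pow, hxa, hxa', hkey]
    rcases sq_eq_sq_iff_eq_or_eq_neg.mp hsq with h | h
    · rw [h]; congr 1; rw [Multiset.singleton_inj]; ring
    · rw [h, add_comm]; congr 1 <;> rw [Multiset.singleton_inj] <;> ring

end Core

/-! ### The inducing characters of a self-twisting cuspidal representation (Arthur–Clozel (b)) -/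

section Extraction

variable {F E : Type} [Field F] [NumberField F] [Field E] [NumberField E] [Algebra F E]

/-- **`π = I_K^F(μ)` at the level of Hecke eigenvalues** (Labesse–Langlands / op. cit. Prop. 2.3.1
(2): "The image of `I_{K/F}` consists precisely of those `π` such that `π ≅ π ⊗ χ_{K/F}`", here
through Arthur–Clozel, Ch. 3, Thm. 4.2 (b), the named fact
`ArthurClozel1989_inducedLift_of_twist_eq 2 F E`): for a cuspidal `π` on `GL_2(𝔸_F)` with
`π ⊗ η = π`, `η` the class-field character of the quadratic `E/F`, there is a cuspidal `Π₁` on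
`GL_1(𝔸_E)` — a unitary Hecke character `μ` of `E` trivial on `A_G` — with `Π₁ × Π₁^σ` lifting
`π`: `{μ(ϖ_w)} + {μ^σ(ϖ_w)} = t_{π,v}^{f(w|v)}` for almost all `w ∣ v`
(`IsWeakBaseChangeLiftOfGalOrbit.eventually_sum_eq_map_pow`, the `GL(1)` dictionary
`IsSatakeFamilyOf.eq_singleton_valueAtUniformizer` and `heckeCharacter_galConj_apply`).
[cite: Ramakrishnan2000, Prop. 2.3.1 (2)] [cite: ArthurClozelAMS120, Ch. 3, Thm. 4.2 (b)] -/
theorem exists_inducing_heckeCharacters_of_twist_eq [IsGalois F E] (h2 : Module.finrank F E = 2)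
    (hAC : ArthurClozel1989_inducedLift_of_twist_eq 2 F E)
    {η : HeckeCharacter F} (hη : η.IsClassFieldCharacter E)
    {μ₀ : Measure (gl 2 F).automorphicQuotient} [(gl 2 F).IsAutomorphicMeasure μ₀]
    (P : CuspidalAutomorphicRepGL 2 F μ₀) (hP : P.twistByFiniteOrderChar η hη.isFiniteOrder = P)
    {S : Set (HeightOneSpectrum (𝓞 F))} {β : SatakeFamily F} (hβ : IsSatakeFamilyOf P S β)
    {σ : E ≃ₐ[F] E} (hσ : σ ≠ 1) :
    ∃ μ μσ : HeckeCharacter E, (∀ x, μσ x = μ (σ⁻¹ • x)) ∧ μ.IsUnitary ∧ μσ.IsUnitary ∧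
      (∀ t, μ (posRealIdele E t) = 1) ∧ (∀ t, μσ (posRealIdele E t) = 1) ∧
      ∀ᶠ w : HeightOneSpectrum (𝓞 E) in cofinite, w.under (𝓞 F) ∉ S →
        ({μ.valueAtUniformizer w} + {μσ.valueAtUniformizer w} : Multiset ℂ) =
          (β (w.under (𝓞 F))).map (· ^ w.asIdeal.inertiaDeg (𝓞 F)) := by
  classical
  haveI : FiniteDimensional F E := Module.finite_of_finrank_pos (by rw [h2]; exact two_pos)
  have hprime : (Module.finrank F E).Prime := by rw [h2]; exact Nat.prime_two
  obtain ⟨-, ν, hνA, hν, Q₁, -, hlift⟩ := hAC two_pos hprime η hη μ₀ P hP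
  haveI := hνA
  -- transport the rank `2 / [E:F]` of `Π₁` to `1`
  suffices key : ∀ (m : ℕ) (ν : Measure (gl m E).automorphicQuotient)
      [(gl m E).IsAutomorphicMeasure ν] (hν : IsGalInvariant F ν)
      (Q₁ : CuspidalAutomorphicRepGL m E ν), IsWeakBaseChangeLiftOfGalOrbit P.1 Q₁ hν → m = 1 →
      ∃ μ μσ : HeckeCharacter E, (∀ x, μσ x = μ (σ⁻¹ • x)) ∧ μ.IsUnitary ∧ μσ.IsUnitary ∧
        (∀ t, μ (posRealIdele E t) = 1) ∧ (∀ t, μσ (posRealIdele E t) = 1) ∧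
        ∀ᶠ w : HeightOneSpectrum (𝓞 E) in cofinite, w.under (𝓞 F) ∉ S →
          ({μ.valueAtUniformizer w} + {μσ.valueAtUniformizer w} : Multiset ℂ) =
            (β (w.under (𝓞 F))).map (· ^ w.asIdeal.inertiaDeg (𝓞 F)) by
    exact key _ ν hν Q₁ hlift (by rw [h2])
  intro m ν _ hν Q₁ hlift hm
  subst hm
  refine ⟨Q₁.heckeCharacter, (Q₁.galConj F hν σ).heckeCharacter,
    fun x => CuspidalAutomorphicRepGL.heckeCharacter_galConj_apply F hν Q₁ σ x,
    Q₁.isUnitary_heckeCharacter, (Q₁.galConj F hν σ).isUnitary_heckeCharacter,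
    Q₁.heckeCharacter_posRealIdele, (Q₁.galConj F hν σ).heckeCharacter_posRealIdele, ?_⟩
  obtain ⟨S₁, A₁, -, hA₁⟩ := exists_isSatakeFamilyOf_holds (n := 1) (K := E) (μ := ν) Q₁
  have hrel := hlift.eventually_sum_eq_map_pow hβ fun τ => hA₁.galConj F hν τ
  have hS0 : ∀ᶠ w : HeightOneSpectrum (𝓞 E) in cofinite,
      w ∉ (↑S₁ : Set (HeightOneSpectrum (𝓞 E))) :=
    S₁.finite_toSet.eventually_cofinite_notMem
  have hSσ : ∀ᶠ w : HeightOneSpectrum (𝓞 E) in cofinite,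
      ∀ τ : E ≃ₐ[F] E, τ⁻¹ • w ∉ (↑S₁ : Set (HeightOneSpectrum (𝓞 E))) :=
    eventually_all.2 fun τ => (tendsto_inv_smul_cofinite (𝓞 E) τ).eventually hS0
  have huniv : (Finset.univ : Finset (E ≃ₐ[F] E)) = {1, σ} := by
    ext τ
    simpa using gal_eq_one_or_eq_dih h2 hσ τ
  filter_upwards [hrel, hSσ] with w hr hσw hwS
  have h := hr hwS fun τ => hσw τ
  rw [huniv, Finset.sum_pair (Ne.symm hσ), inv_one, one_smul] at h
  have h1 : A₁ w = {Q₁.heckeCharacter.valueAtUniformizer w} := by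
    refine hA₁.eq_singleton_valueAtUniformizer ?_
    have := hσw 1
    rwa [inv_one, one_smul] at this
  have h2' : A₁ (σ⁻¹ • w) = {(Q₁.galConj F hν σ).heckeCharacter.valueAtUniformizer w} :=
    (hA₁.galConj F hν σ).eq_singleton_valueAtUniformizer (v := w) (hσw σ)
  rw [h1, h2'] at h
  exact h

end Extraction

/-! ### Assembly: the both-dihedral case of Thm. 4.1.2 from named facts -/

section Assembly

variable {F : Type} [Field F] [NumberField F]

/-- Cancel a non-zero scalar: `β.map (d * ·) = γ` gives `β = γ.map (d⁻¹ * ·)`. [folklore] -/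
private theorem eq_map_inv_mul_of_map_mul_eq_dih {β γ : Multiset ℂ} {d : ℂ} (hd : d ≠ 0)
    (h : β.map (d * ·) = γ) : β = γ.map (d⁻¹ * ·) := by
  rw [← h, Multiset.map_map]
  conv_lhs => rw [← Multiset.map_id β]
  refine Multiset.map_congr rfl fun x _ => ?_
  simp only [Function.comp_apply, id_eq]
  rw [← mul_assoc, inv_mul_cancel₀ hd, one_mul]

/-- `q_v^s ≠ 0`. [folklore] -/
private theorem residueCard_cpow_ne_zero_dih (v : HeightOneSpectrum (𝓞 F)) (s : ℂ) :
    ((v.residueCard : ℂ) ^ s) ≠ 0 := by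
  intro h
  have h1 := (Complex.cpow_eq_zero_iff _ _).1 h
  have h2 : (v.residueCard : ℂ) ≠ 0 := by
    have := v.one_lt_residueCard
    exact_mod_cast (by omega : v.residueCard ≠ 0)
  exact h2 h1.1

/-- **A Satake-level self-twist is an honest self-twist in `L²_cusp`** (strong multiplicity one).
Let `ρ` be a cuspidal datum on `GL(2)/F` whose Satake parameters off the finite `S` are
`q_v^{s} α_P(v)` for a Satake family `α_P` of the cuspidal `P ≤ L²_cusp(GL_2(𝔸_F))` (the unitary
normalisation), and `δ` a Hecke character of finite order with `t_{ρ,v} = δ(ϖ_v) t_{ρ,v}` a.e. Then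
`δ(ϖ_v) α_P(v) = α_P(v)` a.e., and `P ⊗ δ = P` in `L²_cusp`: `P ⊗ δ` has the Satake family
`δ(ϖ_v) α_P(v)` (`IsSatakeFamilyOf.twistByChar`), which agrees with `α_P` off a finite set, so
strong multiplicity one in Satake-family form (`eq_of_isSatakeFamilyOf_of_jacquetShalika`, from
multiplicity one and Jacquet–Shalika (2.2)–(2.3) over `F`) applies.
[cite: Ramakrishnan2000, §4.1, proof of Thm. 4.1.2 (p. 38)] -/
theorem twistByFiniteOrderChar_eq_self_of_isSatakeTwistBy {h2 : isCompact_glFiniteIntegralLevel 2 F}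
    {μ₀ : Measure (gl 2 F).automorphicQuotient} [(gl 2 F).IsAutomorphicMeasure μ₀]
    (hm1 : multiplicity_one_gl 2 F μ₀)
    (h22 : JacquetShalika1981_partialPairL_at_one_of_ne_conj (n := 2) (K := F) (μ := μ₀))
    (h23 : JacquetShalika1981_partialPairL_pole_of_eq_conj (n := 2) (K := F) (μ := μ₀))
    {δ : HeckeCharacter F} (hfo : δ.IsFiniteOrder) (ρ : CuspidalAutomorphicRepData 2 F h2)
    {s : ℂ} {P : CuspidalAutomorphicRepGL 2 F μ₀} {S : Set (HeightOneSpectrum (𝓞 F))}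
    (hS : S.Finite) {αP : SatakeFamily F} (hαP : IsSatakeFamilyOf P S αP)
    (hiff : ∀ w ∉ S, ∀ β : Multiset ℂ,
      ρ.1.HasSatakeParamAt w β ↔ β = (αP w).map (((w.residueCard : ℂ) ^ s) * ·))
    (hδ : IsSatakeTwistBy ρ.1 ρ.1 δ) :
    (∀ᶠ v : HeightOneSpectrum (𝓞 F) in cofinite, (αP v).map (δ.valueAtUniformizer v * ·) = αP v) ∧
      P.twistByFiniteOrderChar δ hfo = P := by
  classical
  have hfix : ∀ᶠ v : HeightOneSpectrum (𝓞 F) in cofinite,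
      (αP v).map (δ.valueAtUniformizer v * ·) = αP v := by
    filter_upwards [hδ, hS.eventually_cofinite_notMem] with v hv hvS
    have h1 : ρ.1.HasSatakeParamAt v ((αP v).map (((v.residueCard : ℂ) ^ s) * ·)) :=
      (hiff v hvS _).2 rfl
    have h3 := (hiff v hvS _).1 (hv _ h1)
    exact multiset_map_mul_eq_self_of_map_mul_eq (residueCard_cpow_ne_zero_dih v s) h3
  refine ⟨hfix, ?_⟩
  -- a level of `δ` and the enlarged exceptional set
  obtain ⟨𝔪, h𝔪, hδ𝔪⟩ := HeckeCharacter.exists_level_of_isFiniteOrder 2 hfo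
  set S' : Set (HeightOneSpectrum (𝓞 F)) :=
    S ∪ {v | v.asIdeal ∣ 𝔪} ∪ {v | ¬ (αP v).map (δ.valueAtUniformizer v * ·) = αP v} with hS'def
  have hS'fin : S'.Finite :=
    (hS.union (Ideal.finite_factors h𝔪)).union (Filter.eventually_cofinite.mp hfix)
  have hαS' : IsSatakeFamilyOf P S' αP :=
    hαP.mono fun v hv => Set.mem_union_left _ (Set.mem_union_left _ hv)
  have hS'𝔪 : ∀ v ∉ S', ¬ v.asIdeal ∣ 𝔪 := fun v hv hd =>
    hv (Set.mem_union_left _ (Set.mem_union_right _ hd))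
  have hS'fix : ∀ v ∉ S', (αP v).map (δ.valueAtUniformizer v * ·) = αP v := by
    intro v hv
    by_contra hc
    exact hv (Set.mem_union_right _ hc)
  have hδ₀ : ∀ t, δ (posRealIdele F t) = 1 := fun t =>
    HeckeCharacter.map_posRealIdele_of_isFiniteOrder hfo t
  have htw : IsSatakeFamilyOf (P.twistByFiniteOrderChar δ hfo) S'
      fun v => (αP v).map (δ.valueAtUniformizer v * ·) :=
    hαS'.twistByChar δ hfo.isUnitary hδ₀ h𝔪 hδ𝔪 hS'𝔪
  have htw' : IsSatakeFamilyOf (P.twistByFiniteOrderChar δ hfo) S' αP := htw.congr hS'fix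
  exact CuspidalAutomorphicRepGL.eq_of_isSatakeFamilyOf_of_jacquetShalika two_pos hm1 h22 h23
    hS'fin htw' hαS'

/-- **The both-dihedral case of Thm. 4.1.2 from named facts** — the hypothesis `hdih` of
`Ramakrishnan2000_multiplicityOneSL2.of_theoremM` (printed proof, op. cit. p. 38: "`π, π'` both
dihedral … `π = I_K^F(μ)`, `π' = I_K^F(μ')` … `μ' = μ χ_K` … `π' ≅ π ⊗ χ`"). For cuspidal data
`π, π'` on `GL(2)/F` with `(LL)` and non-trivial self-twists: the self-twist `δ` of `π` is quadratic
(`IsSatakeSelfTwist.exists_pow_eq_one`) and twists `π'` too (`isSatakeTwistBy_self_of_LL_right`);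
`δ = η_{E/F}` for a quadratic `E` (`HeckeCharacter.exists_isClassFieldCharacter_of_sq_eq_one`,
class field theory); in the unitary `L²` normalisation `t_π = q^s α_P`
(`exists_satake_eq_cpow_mul_L2_of_clean`, Borel–Jacquet leaves `hAss`, `hL2`, `hss`), `P ⊗ δ = P`
(`twistByFiniteOrderChar_eq_self_of_isSatakeTwistBy`, multiplicity one `hm1` and Jacquet–Shalika `h22`, `h23`
over `F`), so `P`, `P'` are induced from Hecke characters `μ, μ'` of `E`
(`exists_inducing_heckeCharacters_of_twist_eq`, Arthur–Clozel Thm. 4.2 (b) `hAC`); the model-free core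
`Ramakrishnan2000_dihedral_core` (Tate's continuation `hT` over `E`, Hilbert 90) gives `α_{P'} = χ(ϖ_v) α_P`
a.e., and untwisting the normalisations `t_{π'} = (χ ‖·‖^{s-s'})(ϖ_v) t_π` a.e.
[cite: Ramakrishnan2000, §4.1, proof of Thm. 4.1.2 (p. 38)] -/
theorem Ramakrishnan2000_multiplicityOneSL2.dihedral_of_AC
    (hT : ∀ (E : Type) [Field E] [NumberField E] (χ : HeckeCharacter E),
      heckeLFunction_hasEntireContinuation_of_not_isNormTwist χ)
    (hAC : ∀ (F E : Type) [Field F] [NumberField F] [Field E] [NumberField E] [Algebra F E]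
      [FiniteDimensional F E], ArthurClozel1989_inducedLift_of_twist_eq 2 F E)
    (hm1 : ∀ (F : Type) [Field F] [NumberField F] (μ : Measure (gl 2 F).automorphicQuotient)
      [(gl 2 F).IsAutomorphicMeasure μ], multiplicity_one_gl 2 F μ)
    (h22 : ∀ (F : Type) [Field F] [NumberField F] (μ : Measure (gl 2 F).automorphicQuotient)
      [(gl 2 F).IsAutomorphicMeasure μ],
      JacquetShalika1981_partialPairL_at_one_of_ne_conj (n := 2) (K := F) (μ := μ))
    (h23 : ∀ (F : Type) [Field F] [NumberField F] (μ : Measure (gl 2 F).automorphicQuotient)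
      [(gl 2 F).IsAutomorphicMeasure μ],
      JacquetShalika1981_partialPairL_pole_of_eq_conj (n := 2) (K := F) (μ := μ))
    (hAss : ∀ (F : Type) [Field F] [NumberField F] (h2 : isCompact_glFiniteIntegralLevel 2 F)
      (μ : Measure (gl 2 F).automorphicQuotient) [(gl 2 F).IsAutomorphicMeasure μ],
      AutomorphicRepsGL.exists_isAssociatedL2 h2 μ)
    (hL2 : ∀ (F : Type) [Field F] [NumberField F] (h2 : isCompact_glFiniteIntegralLevel 2 F)
      (μ : Measure (gl 2 F).automorphicQuotient) [(gl 2 F).IsAutomorphicMeasure μ],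
      hasSatakeParamAt_iff_L2 h2 μ)
    (hss : ∀ (F : Type) [Field F] [NumberField F] (h2 : isCompact_glFiniteIntegralLevel 2 F),
      AutomorphicRepsGL.stable_cuspidal_eq_sSup_irreducible h2)
    (F : Type) [Field F] [NumberField F] (h2 : isCompact_glFiniteIntegralLevel 2 F)
    (π π' : CuspidalAutomorphicRepData 2 F h2)
    (hLL : ∀ᶠ v : HeightOneSpectrum (𝓞 F) in cofinite, ∃ (α : Multiset ℂ) (c : ℂ), c ≠ 0 ∧
      π.1.HasSatakeParamAt v α ∧ π'.1.HasSatakeParamAt v (α.map (c * ·)))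
    (hπ : IsSatakeSelfTwist π.1) (_hπ' : IsSatakeSelfTwist π'.1) :
    ∃ χ : HeckeCharacter F, IsSatakeTwistBy π.1 π'.1 χ := by
  classical
  -- the quadratic character `δ` twisting both `π` and `π'`, and its field `E`
  obtain ⟨δ, hδ1, hδ2, hδ⟩ := hπ.exists_pow_eq_one
  have hδ' : IsSatakeTwistBy π'.1 π'.1 δ := isSatakeTwistBy_self_of_LL_right π.1 π'.1 hLL hδ
  have hfo : δ.IsFiniteOrder := isOfFinOrder_iff_pow_eq_one.mpr ⟨2, two_pos, hδ2⟩
  obtain ⟨E, _, _, _, _, hdeg, hcf⟩ := δ.exists_isClassFieldCharacter_of_sq_eq_one hδ2 hδ1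
  haveI : FiniteDimensional F E := Module.finite_of_finrank_pos (by rw [hdeg]; exact two_pos)
  have hprime : (Module.finrank F E).Prime := by rw [hdeg]; exact Nat.prime_two
  have hcard : Nat.card (E ≃ₐ[F] E) = 2 := by rw [IsGalois.card_aut_eq_finrank, hdeg]
  obtain ⟨σ, hσ, -⟩ := (Nat.card_eq_two_iff' (1 : E ≃ₐ[F] E)).mp hcard
  -- the unitary `L²` normalisations of `π`, `π'`
  obtain ⟨μ₀, hμ₀⟩ := AdelicGroupData.exists_isAutomorphicMeasure_gl_holds 2 F
  haveI := hμ₀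
  haveI : NeZero (2 : ℕ) := ⟨two_ne_zero⟩
  obtain ⟨π₀, h0W', h0π⟩ :=
    CuspidalAutomorphicRepData.exists_clean_hasSatakeParamAt_of_sSup_irreducible (hss F h2) π
  obtain ⟨s, P, S, αP, hS, hαP, hiff⟩ :=
    CuspidalAutomorphicRepData.exists_satake_eq_cpow_mul_L2_of_clean (hAss F h2 μ₀) (hL2 F h2 μ₀)
      π π₀ h0W' h0π
  obtain ⟨π₀', h0W'', h0π'⟩ :=
    CuspidalAutomorphicRepData.exists_clean_hasSatakeParamAt_of_sSup_irreducible (hss F h2) π'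
  obtain ⟨s', P', S', αP', hS', hαP', hiff'⟩ :=
    CuspidalAutomorphicRepData.exists_satake_eq_cpow_mul_L2_of_clean (hAss F h2 μ₀) (hL2 F h2 μ₀)
      π' π₀' h0W'' h0π'
  -- `P ⊗ δ = P`, `P' ⊗ δ = P'`
  obtain ⟨hfixP, hPP⟩ := twistByFiniteOrderChar_eq_self_of_isSatakeTwistBy (hm1 F μ₀) (h22 F μ₀) (h23 F μ₀)
    hfo π hS hαP hiff hδ
  obtain ⟨-, hPP'⟩ := twistByFiniteOrderChar_eq_self_of_isSatakeTwistBy (hm1 F μ₀) (h22 F μ₀) (h23 F μ₀)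
    hfo π' hS' hαP' hiff' hδ'
  -- rewrite the twists through the class-field character proof term
  have hPP₁ : P.twistByFiniteOrderChar δ hcf.isFiniteOrder = P := hPP
  have hPP₁' : P'.twistByFiniteOrderChar δ hcf.isFiniteOrder = P' := hPP'
  -- the inducing characters
  obtain ⟨μ, μσ, hμσ, hu, huσ, hA, hAσ, hrel⟩ :=
    exists_inducing_heckeCharacters_of_twist_eq hdeg (hAC F E) hcf P hPP₁ hαP hσ
  obtain ⟨μ', μ'σ, hμ'σ, hu', hu'σ, hA', hA'σ, hrel'⟩ :=
    exists_inducing_heckeCharacters_of_twist_eq hdeg (hAC F E) hcf P' hPP₁' hαP' hσ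
  -- `(LL)` for the normalised families
  have hLLα : ∀ᶠ v : HeightOneSpectrum (𝓞 F) in cofinite,
      ∃ c : ℂ, c ≠ 0 ∧ αP' v = (αP v).map (c * ·) := by
    filter_upwards [hLL, hS.eventually_cofinite_notMem, hS'.eventually_cofinite_notMem]
      with v hv hvS hvS'
    obtain ⟨α, c, hc, hα, hα'⟩ := hv
    have e1 := (hiff v hvS α).1 hα
    have e2 := (hiff' v hvS' _).1 hα'
    have hq := residueCard_cpow_ne_zero_dih v s
    have hq' := residueCard_cpow_ne_zero_dih v s'
    refine ⟨((v.residueCard : ℂ) ^ s')⁻¹ * c * (v.residueCard : ℂ) ^ s,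
      mul_ne_zero (mul_ne_zero (inv_ne_zero hq') hc) hq, ?_⟩
    rw [eq_map_inv_mul_of_map_mul_eq_dih hq' e2.symm, e1, Multiset.map_map, Multiset.map_map]
    refine Multiset.map_congr rfl fun x _ => ?_
    simp only [Function.comp_apply]
    ring
  -- the self-twist at the inert places: `-α_P(v) = α_P(v)`
  have hst : ∀ᶠ w : HeightOneSpectrum (𝓞 E) in cofinite, w.asIdeal.inertiaDeg (𝓞 F) = 2 →
      (αP (w.under (𝓞 F))).map (fun x => -x) = αP (w.under (𝓞 F)) := by
    have hprim := hcf.eventually_isPrimitiveRoot_valueAtUniformizer hprime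
    filter_upwards [(tendsto_under_cofinite (𝓞 F)).eventually hfixP,
      (tendsto_under_cofinite (𝓞 F)).eventually hprim] with w hfw hpw hf
    haveI iw : w.asIdeal.LiesOver (w.under (𝓞 F)).asIdeal := ⟨rfl⟩
    have hfIn : (w.under (𝓞 F)).asIdeal.inertiaDegIn (𝓞 E) = w.asIdeal.inertiaDeg (𝓞 F) :=
      Ideal.inertiaDegIn_eq_inertiaDeg (w.under (𝓞 F)).asIdeal w.asIdeal (E ≃ₐ[F] E)
    rw [hfIn, hf] at hpw
    rw [hpw.eq_neg_one_of_two_right] at hfw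
    simp only [neg_one_mul] at hfw
    exact hfw
  -- the induction relations, unguarded
  have hrel₁ : ∀ᶠ w : HeightOneSpectrum (𝓞 E) in cofinite,
      ({μ.valueAtUniformizer w} + {μσ.valueAtUniformizer w} : Multiset ℂ) =
        (αP (w.under (𝓞 F))).map (· ^ w.asIdeal.inertiaDeg (𝓞 F)) := by
    filter_upwards [hrel, (tendsto_under_cofinite (𝓞 F)).eventually hS.eventually_cofinite_notMem]
      with w hw hwS
    exact hw hwS
  have hrel₁' : ∀ᶠ w : HeightOneSpectrum (𝓞 E) in cofinite,
      ({μ'.valueAtUniformizer w} + {μ'σ.valueAtUniformizer w} : Multiset ℂ) =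
        (αP' (w.under (𝓞 F))).map (· ^ w.asIdeal.inertiaDeg (𝓞 F)) := by
    filter_upwards [hrel', (tendsto_under_cofinite (𝓞 F)).eventually hS'.eventually_cofinite_notMem]
      with w hw hwS
    exact hw hwS
  -- the core
  obtain ⟨χ, hχ⟩ := Ramakrishnan2000_dihedral_core hdeg (hT E) hσ hμσ hμ'σ hu hu' huσ hu'σ hA hA' hAσ hA'σ
    hLLα hst hrel₁ hrel₁'
  -- untwist the normalisations: `t_{π'} = χ(ϖ_v) q_v^{s'-s} t_π`
  obtain ⟨νz, hνz⟩ := exists_heckeCharacter_ideleNorm_cpow F (s - s')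
  refine ⟨χ * νz, ?_⟩
  filter_upwards [hχ, hS.eventually_cofinite_notMem, hS'.eventually_cofinite_notMem]
    with v hv hvS hvS' α hα
  have e1 := (hiff v hvS α).1 hα
  have hq := residueCard_cpow_ne_zero_dih v s
  have hq' := residueCard_cpow_ne_zero_dih v s'
  have hq0 : (v.residueCard : ℂ) ≠ 0 := by
    have := v.one_lt_residueCard
    exact_mod_cast (by omega : v.residueCard ≠ 0)
  have key : α.map ((χ * νz).valueAtUniformizer v * ·) =
      (αP' v).map (((v.residueCard : ℂ) ^ s') * ·) := by
    rw [e1, hv, HeckeCharacter.valueAtUniformizer_mul, HeckeCharacter.valueAtUniformizer_of_cpow hνz v,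
      Complex.cpow_sub _ _ hq0, Multiset.map_map, Multiset.map_map]
    refine Multiset.map_congr rfl fun x _ => ?_
    simp only [Function.comp_apply]
    rw [inv_div]
    field_simp
  rw [key]
  exact (hiff' v hvS' _).2 rfl

end Assembly


/-! ### Thm. 4.1.2 from named facts only -/

section Final

/-- **Ramakrishnan's Thm. 4.1.2 (`Ramakrishnan2000_multiplicityOneSL2`) from named facts of the
tree only** — the printed proof (op. cit. §4.1, pp. 37–39) with every step either proved in the
tree or an existing named fact: (a) the cuspidality criterion of Theorem M
(`Ramakrishnan2000_theoremM`); (b) Lemma 4.1.4 (`Ramakrishnan2000_lemma414_of_JS_of_sSup_irreducible`: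
Jacquet–Shalika (2.1)–(2.3) for Borel–Jacquet data `hJ1`–`hJ3`, Gelbart–Jacquet `hGJ`); (c) the
both-dihedral case (`Ramakrishnan2000_multiplicityOneSL2.dihedral_of_AC`: Tate's continuation of
Hecke `L`-functions `hT`, Arthur–Clozel Thm. 4.2 (b) `hAC`, multiplicity one `hm1` and
Jacquet–Shalika (2.2)–(2.3) in the `L²` model `h22`, `h23`); and the Borel–Jacquet dictionary
between cuspidal data and `L²_cusp` (`hAss`, `hL2`, `hss`) shared by (b) and (c).
[cite: Ramakrishnan2000, Theorem 4.1.2 and §4.1 (proof)] -/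
theorem Ramakrishnan2000_multiplicityOneSL2.of_named_facts (hM : Ramakrishnan2000_theoremM)
    (hJ1 : JacquetShalika1981_multipliable_partialPairL_repData)
    (hJ2 : JacquetShalika1981_partialPairL_boundary_repData)
    (hJ3 : JacquetShalika1981_partialPairL_pole_repData)
    (hGJ : GelbartJacquet_adjoint_lift)
    (hT : ∀ (E : Type) [Field E] [NumberField E] (χ : HeckeCharacter E),
      heckeLFunction_hasEntireContinuation_of_not_isNormTwist χ)
    (hAC : ∀ (F E : Type) [Field F] [NumberField F] [Field E] [NumberField E] [Algebra F E]
      [FiniteDimensional F E], ArthurClozel1989_inducedLift_of_twist_eq 2 F E)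
    (hm1 : ∀ (F : Type) [Field F] [NumberField F] (μ : Measure (gl 2 F).automorphicQuotient)
      [(gl 2 F).IsAutomorphicMeasure μ], multiplicity_one_gl 2 F μ)
    (h22 : ∀ (F : Type) [Field F] [NumberField F] (μ : Measure (gl 2 F).automorphicQuotient)
      [(gl 2 F).IsAutomorphicMeasure μ],
      JacquetShalika1981_partialPairL_at_one_of_ne_conj (n := 2) (K := F) (μ := μ))
    (h23 : ∀ (F : Type) [Field F] [NumberField F] (μ : Measure (gl 2 F).automorphicQuotient)
      [(gl 2 F).IsAutomorphicMeasure μ],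
      JacquetShalika1981_partialPairL_pole_of_eq_conj (n := 2) (K := F) (μ := μ))
    (hAss : ∀ (F : Type) [Field F] [NumberField F] (h2 : isCompact_glFiniteIntegralLevel 2 F)
      (μ : Measure (gl 2 F).automorphicQuotient) [(gl 2 F).IsAutomorphicMeasure μ],
      AutomorphicRepsGL.exists_isAssociatedL2 h2 μ)
    (hL2 : ∀ (F : Type) [Field F] [NumberField F] (h2 : isCompact_glFiniteIntegralLevel 2 F)
      (μ : Measure (gl 2 F).automorphicQuotient) [(gl 2 F).IsAutomorphicMeasure μ],
      hasSatakeParamAt_iff_L2 h2 μ)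
    (hss : ∀ (F : Type) [Field F] [NumberField F] (h2 : isCompact_glFiniteIntegralLevel 2 F),
      AutomorphicRepsGL.stable_cuspidal_eq_sSup_irreducible h2) :
    Ramakrishnan2000_multiplicityOneSL2 :=
  Ramakrishnan2000_multiplicityOneSL2.of_theoremM_of_JS_of_leaves hM hJ1 hJ2 hJ3 hGJ hAss hL2 hss
    fun F _ _ h2 π π' hLL hπ hπ' =>
      Ramakrishnan2000_multiplicityOneSL2.dihedral_of_AC hT hAC hm1 h22 h23 hAss hL2 hss F h2 π π'
        hLL hπ hπ'

end Final

end Literature.NumberTheory.Automorphic
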